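import Literature.MathematicalPhysics.QuantumFieldTheory.Balaban1983to89.B6Lemma24TwoScale
import Literature.MathematicalPhysics.QuantumFieldTheory.Balaban1983to89.B6SectALemma24OneLevelV1

/-!
# `Balaban1983to89.B6SectALemma24TwoLevelV1` — T. Bałaban, *Propagators and renormalization transformations for lattice gauge theories. II*,
# Commun. Math. Phys. **96** (1984) 223–250 [Balaban1984PropagatorsII], Lemma 2.4 (2.128) p. 245 for the TWO-LEVEL CUBE (2.89) p. 239:
# **THE TWO-SCALE LEMMA-2.4 LETTER ON THE V1 TORUS CALCULUS** (a bond configuration of `T^{(0)}` supported near a cube meeting `Ω_{j+1}`)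

statement-level skeleton of published theorems with citation tags; proofs where landed; nothing here is a claim about the Yang–Mills mass gap

PDF held: `paper:balaban1984-cmp96-propagators-rt-ii` (journal page = PDF page + 222), pp. 239, 244–245.

CITATION HEADER (lean-in-tree rule).  Cell `pub-ymgap` (Track A, HUMAN RULING D-0062), node N10 [B13] lane owner `pub-ymgap-dag-n10-c` (g18), ROAD «C» station C6c
(bus INBOX 2026-08-28T18:18Z INTENT-2; C6b = `B6Lemma24TwoScale` p656320 + `B6Lemma24TwoScaleBookkeeping` p655911, C4 = `B6SectALemma24OneLevelV1` p648924),
filed `--supports stmt-QuantumFields-27364` (count-neutral helper).  WHY: the local-cube road of N06 row 17 (n06-j's `coer_trIP_deltaALocY_one_of_letters`) displays a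
Lemma-2.4 letter `κ⟨B,B⟩ ≤ ‖∂B‖² + ‖QB‖²_w` for configurations supported near a cover cube; for cubes at ONE level C4 serves, for a cube MEETING `Ω_{j+1}` (print's (2.89)
two-level cube) the `j`-faces into the deeper region are not indices and the letter is the TWO-SCALE one of `B6Lemma24TwoScale` (interface read through `Q_{j+1}`).
THIS FILE transports that ℤᵈ letter to the V1 torus calculus of `Setup` (r03∕p38∕p39 carriers): the fine torus `T^{(0)}` is read in its period box `[0, 2L^{m+K})^d`
(C4's `castZ`∕`toZ`), the cube's blocks of order `j` and `j+1` are given by their corner LABELS `Λs ⊂ Lʲℤ^d`, `Λb ⊂ L^{j+1}ℤ^d` inside the box with a margin of one big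
block (wrapping cubes go through the torus charts of the p21 lineage, `B6MultiLevelTorusOperator.TDomains.chart`, not here), and the configuration is carried over by the
RESTRICTED lift `liftR` (`= B ∘ castZ` on the bonds of the two regions, `0` elsewhere — Lemma 2.4's «B = 0 outside Λ»; C4's periodic `liftB` cannot serve).
IMPORTS `B6Lemma24TwoScale` (C6b) and `B6SectALemma24OneLevelV1` (C4: casts, labels, `liftB`, `q1_liftB`, `d1SqT_liftB`, `stairSum_shift_eq_add`); nothing restated.

THE PRINT (verbatim, p. 245): *«Lemma 2.4. Let a set Λ ⊂ Z^d be a sum of blocks, Λ = B(Λ′). We denote by Λ also a set of bonds b such that at least one of the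
end-points b₋, b₊ belongs to Λ. Let B be a configuration defined on Λ and satisfying the condition (2.121) … We put B = 0 outside Λ. Then …
L^{d−2} Σ_{c∈Λ′} |(Q₁B)(c)|² + Σ_p |(∂₁B)(p)|² ≥ (1∕(12d²)) L^{−d−1} ‖B‖². (2.128)»*; p. 239: *«We define B^j(Λ) = □̃ ∩ B^{j+1}(Λ_{j+1}), (2.89) and we take Q′*aQ′,
Q*aQ equal to Q′*_{j+1}a_{j+1}Q′_{j+1}, Q*_{j+1}a_{j+1}Q_{j+1} on B^j(Λ), and to Q′*_ja_jQ′_j, Q*_ja_jQ_j on □̃ ∖ B^j(Λ)»*.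

WHAT IS DEFINED (bodies displayed; definition lane): `liftR n L Λs Λb B` (the restricted lift), `labSite k y` (the site of `T^{(k)}` whose block has corner labels `y`),
`labBond k c` (the bond of `T^{(k)}` of a coarse label bond).
WHAT IS PROVED (sorry-free; standard axioms; transport of structure + bookkeeping, the one estimate being C6b's kernel theorem):
* §1 `toZ_cornerV1_labSite`, `labSite_injOn`, `labBond_injOn` (labels ↔ sites on the coarse sites of the box); `liftR_of_mem`, `liftR_of_not_mem`, ★ `liftR_eq_liftB`
  (under the SUPPORT hypothesis the restricted and periodic lifts agree on every bond starting in the box).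
* §2 the four terms: ★ `normSq₂_liftR` (`‖B^ℤ‖²_{bonds₂} = ‖B‖²`), ★ `q1Term_liftR_eq` (`|(Q₁B^ℤ)(c)|² = (Q_kB)(c̄)²` at both levels, C4 `q1_liftB` = p39 (1.18)), ★ `d1Sq_liftR_le`
  (`Σ_{p near Λ}(∂₁B^ℤ)² ≤ Σ_p(∂B)(p)²`, C4 `d1SqT_liftB`), ★ `liftB_eq_zero_of_treeBond_at` ((2.121) bond-wise at ONE block from its staircase sums — C4's lemma localised).
* §3 ★★★ **`lemma24_twoLevel_V1`**: levels `j, j+1 ≤ m+K`; `Λs`, `Λb` label corners with margins (`hboxS`, `hboxB`), disjoint regions, admissible big-block neighbours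
  (`Adm` of C6b: big ∕ composite ∕ empty); `B : BondSpace P` supported on the bonds of the two regions (`hsupp`, label form; ★ `supp_of_torusSupport` derives it from
  «every bond carrying `B` has an end point in the two regions») with vanishing staircase sums on each of the cube's blocks (`hTs`, `hTb`):
  **`((L^{j+1})^{d+1})⁻¹·‖B‖² ≤ 12d²(1 + 12d·(Lʲ)²)·( (Lʲ)^{d−2}·Σ_{c∈idxS}(Q_jB)(c̄)² + (L^{j+1})^{d−2}·Σ_{C meeting Λb}(Q_{j+1}B)(C̄)² + 2·Σ_p(∂B)(p)² )`**.
* §4 `sum_weight_QE_twoLevel_ge` (two injections `idxS ↪ 𝔅`, big faces `↪ 𝔅` with disjoint images), ★★★ **`lemma24_letter_twoLevel`**: for a nested `D` with `j + 1 ≤ k`,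
  the small label faces of `idxS` indices at level `j` and the big faces meeting `Λb` indices at level `j+1` (`hIS`, `hIB`), weights `w ≥ w₀ ≥ 0`:
  **`κ·‖B‖² ≤ ‖dcE c B‖² + Σ_i w_i (QE D B)_i²`**, `κ = (12d²(1+12d·L^{2j}))⁻¹·((L^{j+1})^{d+1})⁻¹·min(c²∕2, w₀∕(L^{j+1})^{d−2})` — the `hL24` hypothesis of C1's
  `deltaAE_coercive_of_treeGauge_letters'` for the interface cubes; `lemma24_letter_twoLevel_const_pos`.
HONEST SCOPE.  (i) The inequality is the cell's two-scale analogue of (2.128) for print's (2.89), transported; nothing printed is asserted or used as a hypothesis.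
(ii) The box margin (one big block on each side, in label coordinates) is an honest restriction: cubes wrapping around the torus are reached through the p21 torus charts
by the consumer.  (iii) The constant is explicit and volume-free but level-dependent (`L^{2j}`, `(L^{j+1})^{d+1}`), as C4's; no `k`-uniformity is claimed.  (iv) Which
cover cubes satisfy the admissibility (every `L^{j+1}`-neighbour of the cube's big blocks is big, composite or empty — i.e. the cube's level-`j` part is a union of
`(j+1)`-positions next to its big blocks) and the index hypotheses is the consumer's geometry ((2.2) separation, def-Y's cube data); not decided here.  (v) §5 (v1.1,
append-only): ★★★ `lemma24_twoLevel_V1_noAdm` ∕ `lemma24_letter_twoLevel_noAdm` — the same conclusions WITHOUT the admissibility hypothesis (over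
`B6Lemma24TwoScale.lemma24_twoScale_noAdm`): positions next to big blocks and outside `Λb` are generalised composites, so def-Y's non-aligned `cubeDomY` (a sup-metric ball
on block centres, bus 2026-08-28T18:20Z) is admitted; only the index hypotheses `hIS`∕`hIB` remain for the consumer.  (vi) §6 (v1.2, append-only): the MASTER editions
`lemma24_twoLevel_V1_tree` ∕ `lemma24_letter_twoLevel_tree` with (2.121) as the vanishing of `liftB B` on the blocks' tree bonds, and `liftB_eq_zero_of_treeBond_or`
(from staircase sums OR from the vanishing of `B` inside the block — the empty big blocks adjacent to a cube).  NOT a node discharge; count-neutral; nothing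
continuum ∕ OS ∕ mass gap ∕ Clay.
-/

open scoped InnerProductSpace

namespace Literature.MathematicalPhysics.QuantumFieldTheory.Balaban1983to89.B6SectALemma24TwoLevelV1

open Finset
open LatticeFieldCalculus B5Eq118OneStroke B5Eq120IterProof B6SectADomainsV1 B6SectAOperatorsV1
open BalabanImbrieJaffe1984to88.BIJ85AxialPropagator411 (BondSpace)
open B6Lemma24Torus (pbox mem_pbox coarseSites mem_coarseSites plaqT mem_plaqT d1SqT)
open B6Elimination (block mem_block corner)
open B6BondElimination (unitVec unitVec_apply add_unitVec_apply add_smul_unitVec_apply sub_smul_unitVec_apply treeBonds mem_treeBonds)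
open B6TreeGaugePoincare (Cfg innerBonds mem_innerBonds)
open B6Lemma24Carrier (lam mem_lam lamBonds mem_lamBonds lamPlaq mem_lamPlaq lamPlaqBase d1Sq coarseBonds q1Term q1Of)
open B6Lemma24Assembly (mem_coarseBonds dvd_of_mem_coarseBonds)
open B6Lemma24PrintedShape (q1 q1_sq)
open B6Lemma24TwoScaleBookkeeping (bonds₂ normSq₂ idxS Adm mem_idxS idxS_subset)
open B6Lemma24TwoScale (lemma24_twoScale)
open B6SectALemma24OneLevelV1 (castZ toZ liftB cornerV1 periodV1 castZ_toZ toZ_castZ_of_mem_pbox toZ_mem_pbox castZ_add_unitVec castZ_add_smul_unitVec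
  sum_pbox_eq_sum_site sitesPerDir_zero_eq_mul toZ_cornerV1 castZ_mem_iterBlock_of_mem_block q1_liftB d1SqT_liftB stairSum_shift_eq_add
  pow_le_half_sitesPerDir normSq_dcE_eq)
open B6SectADeltaACoerciveReductionV1 (normSq_eq_sum_sq sum_bond_eq_sum_site_dir)

noncomputable section

variable {P : Params}

/-! ## §0. The restricted lift and the label sites -/

/-- **the RESTRICTED lift** of a bond configuration of `T^{(0)}` to b06's carrier: `B^ℤ(b) = B(b mod M)` on the bonds of the two regions (`bonds₂`), `0` elsewhere
(Lemma 2.4's *«We put B = 0 outside Λ»*; the periodic lift `liftB` of C4 does not vanish outside). [cite: Balaban1984PropagatorsII, Lemma 2.4 p.245, (2.89) p.239] -/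
def liftR (n L : ℕ) (Λs Λb : Finset (Fin P.d → ℤ)) (B : BondSpace P) : Cfg P.d :=
  fun b => if b ∈ bonds₂ n L Λs Λb then liftB B b else 0

/-- the site of `T^{(k)}` whose block of order `k` has corner labels `y ∈ Lᵏℤ^d ∩ [0, M)^d`. [cite: Balaban1984PropagatorsI, (1.6) p.18] -/
def labSite (k : ℕ) (y : Fin P.d → ℤ) : Site P k := fun i => (((y i / (P.L : ℤ) ^ k).toNat : ℕ) : ZMod (P.sitesPerDir k))

/-- the bond of `T^{(k)}` of a coarse label bond `c = ⟨y, y + Lᵏe_μ⟩`. [cite: Balaban1984PropagatorsI, (1.6)–(1.8) pp.18–19] -/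
def labBond (k : ℕ) (c : (Fin P.d → ℤ) × Fin P.d) : PBond P k := ⟨labSite k c.1, c.2⟩

/-! ## §1. Labels, the restricted lift against the periodic one -/

section Labels

variable {k : ℕ}

/-- the corner of the label site is the label (no wrap-around inside the period box). [cite: Balaban1984PropagatorsI, (1.6) p.18; folklore] -/
theorem toZ_cornerV1_labSite (hk : k ≤ P.m + P.K) {y : Fin P.d → ℤ} (hy : y ∈ coarseSites (P.L ^ k) (periodV1 P)) :
    toZ (cornerV1 k (labSite k y)) = y := by
  have hLk : (0 : ℤ) < (P.L : ℤ) ^ k := pow_pos (by exact_mod_cast P.L_pos) k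
  obtain ⟨hyb, hyd⟩ := mem_coarseSites.1 hy
  funext i
  obtain ⟨h0, h1⟩ := mem_pbox.1 hyb i
  obtain ⟨q, hq⟩ := hyd i
  push_cast at hq
  have hq0 : 0 ≤ q := by nlinarith
  have hqlt : q < P.sitesPerDir k := by
    have h1' : y i < (P.sitesPerDir k : ℤ) * (P.L : ℤ) ^ k := by
      have : ((periodV1 P i : ℕ) : ℤ) = (P.sitesPerDir k : ℤ) * (P.L : ℤ) ^ k := by
        show ((P.sitesPerDir 0 : ℕ) : ℤ) = _
        rw [sitesPerDir_zero_eq_mul hk]; push_cast; ring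
      rw [← this]; exact h1
    rw [hq] at h1'
    nlinarith
  rw [toZ_cornerV1 hk]
  have hv : (labSite k y i).val = q.toNat := by
    simp only [labSite]
    rw [hq, Int.mul_ediv_cancel_left _ hLk.ne', ZMod.val_natCast, Nat.mod_eq_of_lt (by omega)]
  rw [hv]; push_cast; rw [Int.toNat_of_nonneg hq0, hq]; ring

/-- `labSite` is injective on the coarse sites of the box. [cite: Balaban1984PropagatorsI, (1.6) p.18; folklore] -/
theorem labSite_injOn (hk : k ≤ P.m + P.K) : Set.InjOn (labSite (P := P) k) ↑(coarseSites (P.L ^ k) (periodV1 P)) := by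
  intro y hy y' hy' h
  rw [← toZ_cornerV1_labSite hk (mem_coe.1 hy), ← toZ_cornerV1_labSite hk (mem_coe.1 hy'), h]

/-- `labBond` is injective on coarse label bonds with lower end among the coarse sites of the box. [cite: Balaban1984PropagatorsI, (1.6) p.18; folklore] -/
theorem labBond_injOn (hk : k ≤ P.m + P.K) {S : Finset ((Fin P.d → ℤ) × Fin P.d)} (hS : ∀ c ∈ S, c.1 ∈ coarseSites (P.L ^ k) (periodV1 P)) :
    Set.InjOn (labBond (P := P) k) ↑S := by
  intro c hc c' hc' h
  have h1 : labSite (P := P) k c.1 = labSite k c'.1 := congrArg PBond.src h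
  have h2 : c.2 = c'.2 := congrArg PBond.dir h
  exact Prod.ext (labSite_injOn hk (hS c hc) (hS c' hc') h1) h2

variable {n L : ℕ} {Λs Λb : Finset (Fin P.d → ℤ)} {B : BondSpace P}

/-- the restricted lift on the bonds of the two regions. [cite: Balaban1984PropagatorsII, Lemma 2.4 p.245] -/
theorem liftR_of_mem {b : (Fin P.d → ℤ) × Fin P.d} (hb : b ∈ bonds₂ n L Λs Λb) : liftR n L Λs Λb B b = liftB B b := if_pos hb

/-- the restricted lift vanishes off the bonds of the two regions. [cite: Balaban1984PropagatorsII, Lemma 2.4 p.245 («B = 0 outside Λ»)] -/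
theorem liftR_of_not_mem {b : (Fin P.d → ℤ) × Fin P.d} (hb : b ∉ bonds₂ n L Λs Λb) : liftR n L Λs Λb B b = 0 := if_neg hb

/-- ★ under the SUPPORT hypothesis (`B` vanishes on every torus bond whose label representative is not a bond of the two regions) the restricted and the periodic
lifts agree on every bond starting in the period box. [cite: Balaban1984PropagatorsII, Lemma 2.4 p.245; folklore] -/
theorem liftR_eq_liftB (hsupp : ∀ z ∈ pbox (periodV1 P), ∀ μ : Fin P.d, (z, μ) ∉ bonds₂ n L Λs Λb → WithLp.ofLp B ⟨castZ z, μ⟩ = 0)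
    {z : Fin P.d → ℤ} (hz : z ∈ pbox (periodV1 P)) (μ : Fin P.d) : liftR n L Λs Λb B (z, μ) = liftB B (z, μ) := by
  by_cases h : (z, μ) ∈ bonds₂ n L Λs Λb
  · exact liftR_of_mem h
  · rw [liftR_of_not_mem h]
    exact (hsupp z hz μ h).symm

end Labels

/-! ## §2. The four terms of the two-scale letter for the restricted lift -/

section Terms

variable {n L : ℕ} {Λs Λb : Finset (Fin P.d → ℤ)} {B : BondSpace P}

/-- ★ **`‖B^ℤ‖²_{bonds₂} = ‖B‖²`** (support hypothesis; every bond of the two regions starts in the period box). [cite: Balaban1984PropagatorsII, (2.128) p.245] -/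
theorem normSq₂_liftR (hsupp : ∀ z ∈ pbox (periodV1 P), ∀ μ : Fin P.d, (z, μ) ∉ bonds₂ n L Λs Λb → WithLp.ofLp B ⟨castZ z, μ⟩ = 0)
    (hU : ∀ b ∈ bonds₂ n L Λs Λb, b.1 ∈ pbox (periodV1 P)) : normSq₂ n L Λs Λb (liftR n L Λs Λb B) = ‖B‖ ^ 2 := by
  classical
  have h1 : ‖B‖ ^ 2 = ∑ b ∈ pbox (periodV1 P) ×ˢ (univ : Finset (Fin P.d)), liftB B b ^ 2 := by
    rw [normSq_eq_sum_sq, sum_bond_eq_sum_site_dir, sum_product, sum_pbox_eq_sum_site]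
    refine sum_congr rfl fun x _ => sum_congr rfl fun μ _ => ?_
    simp only [liftB, castZ_toZ]
  have hsub : bonds₂ n L Λs Λb ⊆ pbox (periodV1 P) ×ˢ (univ : Finset (Fin P.d)) := fun b hb => mem_product.2 ⟨hU b hb, mem_univ _⟩
  rw [h1, normSq₂, ← sum_subset hsub]
  · exact sum_congr rfl fun b hb => by rw [liftR_of_mem hb]
  · intro b hb hnot
    have hz : b.1 ∈ pbox (periodV1 P) := (mem_product.1 hb).1
    have h := hsupp b.1 hz b.2 (by rw [Prod.mk.eta]; exact hnot)
    simp only [liftB]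
    rw [show (⟨castZ b.1, b.2⟩ : PBond P 0) = ⟨castZ b.1, b.2⟩ from rfl] at h
    rw [h]; ring

/-- ★ **`(Q₁B^ℤ)(c) = (Q_kB)(c̄)`** for a coarse label bond whose lower block and its `μ`-translate lie in the period box (pv09's verbatim (2.125) average = p39's
`k`-fold average, through C4's `q1_liftB`). [cite: Balaban1984PropagatorsII, (2.125) p.245; Balaban1984PropagatorsI, (1.18) p.20] -/
theorem q1Term_liftR_eq {k : ℕ} (hk : k ≤ P.m + P.K)
    (hsupp : ∀ z ∈ pbox (periodV1 P), ∀ μ : Fin P.d, (z, μ) ∉ bonds₂ n L Λs Λb → WithLp.ofLp B ⟨castZ z, μ⟩ = 0)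
    {c : (Fin P.d → ℤ) × Fin P.d} (hc : c.1 ∈ coarseSites (P.L ^ k) (periodV1 P)) (hc2 : ∀ i, c.1 i + 2 * ((P.L ^ k : ℕ) : ℤ) ≤ ((P.sitesPerDir 0 : ℕ) : ℤ)) :
    q1Term (P.L ^ k) (liftR n L Λs Λb B) c = bondAvgIter k (WithLp.ofLp B) (labBond k c) ^ 2 := by
  have hqq : q1 (P.L ^ k) (liftR n L Λs Λb B) c = q1 (P.L ^ k) (liftB B) c := by
    unfold q1 B6Lemma24PrintedShape.segSum
    refine sum_congr rfl fun x hx => ?_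
    congr 1
    refine sum_congr rfl fun s hs => liftR_eq_liftB hsupp (mem_pbox.2 fun i => ?_) c.2
    obtain ⟨h0, h1⟩ := B6Elimination.mem_block.1 hx i
    obtain ⟨hz0, -⟩ := mem_pbox.1 (mem_coarseSites.1 hc).1 i
    have hs' : (s : ℤ) < ((P.L ^ k : ℕ) : ℤ) := Int.ofNat_lt.mpr (mem_range.1 hs)
    rw [add_smul_unitVec_apply]
    have h2 := hc2 i
    have hper : ((periodV1 P i : ℕ) : ℤ) = ((P.sitesPerDir 0 : ℕ) : ℤ) := rfl
    rw [hper]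
    split_ifs with hi
    · constructor <;> omega
    · constructor <;> omega
  have e : c = (toZ (cornerV1 k (labSite (P := P) k c.1)), c.2) := by rw [toZ_cornerV1_labSite hk hc]
  rw [← q1_sq, hqq]
  conv_lhs => rw [e]
  rw [q1_liftB hk B (labSite k c.1) c.2]
  rfl

/-- ★ **the plaquette term of a region is at most `Σ_p (∂B)(p)²`**: for a family of corners `Λ′ ⊂ mℤ^d` whose blocks keep one lattice unit off the box boundary, the
restricted lift's `Σ_{p near Λ} (∂₁B^ℤ)(p)²` is dominated by the torus sum (through C4's `d1SqT_liftB`). [cite: Balaban1984PropagatorsII, (2.128) p.245; Balaban1984PropagatorsI, (1.4) p.18] -/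
theorem d1Sq_liftR_le {m : ℕ} (hsupp : ∀ z ∈ pbox (periodV1 P), ∀ μ : Fin P.d, (z, μ) ∉ bonds₂ n L Λs Λb → WithLp.ofLp B ⟨castZ z, μ⟩ = 0)
    {Λ' : Finset (Fin P.d → ℤ)} (hΛ : ∀ y ∈ Λ', ∀ i, 1 ≤ y i ∧ y i + (m : ℤ) + 1 ≤ ((P.sitesPerDir 0 : ℕ) : ℤ)) :
    d1Sq m Λ' (liftR n L Λs Λb B) ≤ ∑ p : Plaq P 0, LatticeFieldCalculus.curl 1 (WithLp.ofLp B) p ^ 2 := by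
  classical
  -- the base corners of the plaquettes near `Λ` keep inside the box together with one step
  have hbase : ∀ z ∈ lamPlaqBase m Λ', ∀ i, 0 ≤ z i ∧ z i + 1 < ((P.sitesPerDir 0 : ℕ) : ℤ) := by
    intro z hz i
    obtain ⟨y, hy, hzy⟩ := mem_biUnion.1 hz
    have h := (Fintype.mem_piFinset.1 hzy) i
    rw [mem_Ico] at h
    have := hΛ y hy i
    constructor <;> omega
  have hpb : ∀ z, (∀ i, 0 ≤ z i ∧ z i + 1 < ((P.sitesPerDir 0 : ℕ) : ℤ)) → z ∈ pbox (periodV1 P) := fun z h =>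
    mem_pbox.2 fun i => ⟨(h i).1, by show z i < ((P.sitesPerDir 0 : ℕ) : ℤ); have := (h i).2; omega⟩
  have hpb' : ∀ z, (∀ i, 0 ≤ z i ∧ z i + 1 < ((P.sitesPerDir 0 : ℕ) : ℤ)) → ∀ ν, z + unitVec ν ∈ pbox (periodV1 P) := fun z h ν =>
    mem_pbox.2 fun i => by
      rw [add_unitVec_apply]
      have := h i
      show 0 ≤ z i + (if i = ν then 1 else 0) ∧ z i + (if i = ν then 1 else 0) < ((P.sitesPerDir 0 : ℕ) : ℤ)
      split_ifs <;> constructor <;> omega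
  have hcurl : ∀ p ∈ lamPlaq m Λ', B6TreeGaugePoincare.curl (liftR n L Λs Λb B) p.1 p.2.1 p.2.2 = B6TreeGaugePoincare.curl (liftB B) p.1 p.2.1 p.2.2 := by
    intro p hp
    have hz := hbase p.1 (mem_lamPlaq.1 hp).1
    simp only [B6TreeGaugePoincare.curl]
    rw [liftR_eq_liftB hsupp (hpb _ hz), liftR_eq_liftB hsupp (hpb _ hz), liftR_eq_liftB hsupp (hpb' _ hz _), liftR_eq_liftB hsupp (hpb' _ hz _)]
  rw [← d1SqT_liftB, d1Sq, d1SqT, sum_congr rfl fun p hp => by rw [hcurl p hp]]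
  refine sum_le_sum_of_subset_of_nonneg (fun p hp => ?_) fun _ _ _ => sq_nonneg _
  obtain ⟨hb, hlt⟩ := mem_lamPlaq.1 hp
  exact mem_plaqT.2 ⟨hpb _ (hbase _ hb), hlt⟩

/-- ★ **(2.121) bond-wise at ONE block from its staircase sums** (C4's `liftB_eq_zero_of_treeBond`, localised): if the staircase sums of `B` from the corner vanish on
the block `Bᵏ(ȳ)`, the periodic lift vanishes on every bond of b06's tree over the corner's labels. [cite: Balaban1984PropagatorsII, (2.121) p.244; Balaban1984PropagatorsI, (1.7) p.18] -/
theorem liftB_eq_zero_of_treeBond_at {k : ℕ} (hk : k ≤ P.m + P.K) (B : BondSpace P) (yk : Site P k)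
    (hT : ∀ x ∈ iterBlock k yk, stairSum (WithLp.ofLp B) (cornerV1 k yk) x = 0) :
    ∀ b ∈ treeBonds (P.L ^ k) (toZ (cornerV1 k yk)), liftB B b = 0 := by
  -- adapted from `B6SectALemma24OneLevelV1.liftB_eq_zero_of_treeBond` (one block instead of all coarse sites)
  intro b hb
  obtain ⟨hw, hpre, hlast⟩ := mem_treeBonds.1 hb
  have hx : castZ b.1 ∈ iterBlock k yk := castZ_mem_iterBlock_of_mem_block hk yk hw
  have hw' : b.1 + unitVec b.2 ∈ B6Elimination.block (P.L ^ k) (toZ (cornerV1 k yk)) := by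
    refine B6Elimination.mem_block.2 fun i => ?_
    obtain ⟨h0, h1⟩ := B6Elimination.mem_block.1 hw i
    rw [show b.1 + unitVec b.2 = b.1 + (1 : ℤ) • unitVec b.2 by rw [one_smul], add_smul_unitVec_apply]
    by_cases h : i = b.2
    · subst h; rw [if_pos rfl]; constructor <;> omega
    · rw [if_neg h]; constructor <;> omega
  have hx' : (castZ b.1).shift b.2 ∈ iterBlock k yk := by rw [← castZ_add_unitVec]; exact castZ_mem_iterBlock_of_mem_block hk yk hw'
  obtain ⟨h0, h1⟩ := B6Elimination.mem_block.1 hw b.2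
  set t : ℕ := (b.1 b.2 - toZ (cornerV1 k yk) b.2).toNat with htdef
  have ht0 : (t : ℤ) = b.1 b.2 - toZ (cornerV1 k yk) b.2 := Int.toNat_of_nonneg (by omega)
  have htn : t + 1 + 1 ≤ P.L ^ k := by zify; rw [ht0]; push_cast at hlast ⊢; omega
  have ht1 : t + 1 ≤ P.sitesPerDir 0 / 2 := le_trans (by omega) (pow_le_half_sitesPerDir hk)
  have hcμ : (castZ (P := P) b.1) b.2 - cornerV1 k yk b.2 = ((t : ℕ) : ZMod (P.sitesPerDir 0)) := by
    have hc : cornerV1 k yk b.2 = castZ (toZ (cornerV1 k yk)) b.2 := by rw [castZ_toZ]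
    rw [hc]
    simp only [castZ]
    rw [← Int.cast_sub, ← ht0, Int.cast_natCast]
  have ht : ((castZ (P := P) b.1) b.2 - cornerV1 k yk b.2).valMinAbs = t := by
    rw [hcμ, ZMod.valMinAbs_natCast_of_le_half (le_trans (Nat.le_succ t) ht1)]
  have hpre' : ∀ ν, ν < b.2 → (castZ (P := P) b.1) ν = cornerV1 k yk ν := by
    intro ν hν
    have hc : cornerV1 k yk ν = castZ (toZ (cornerV1 k yk)) ν := by rw [castZ_toZ]
    rw [hc]; simp only [castZ, hpre ν hν]
  have hstep := stairSum_shift_eq_add (WithLp.ofLp B) (cornerV1 k yk) (castZ b.1) b.2 hpre' ht ht1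
  rw [hT _ hx, hT _ hx', zero_add] at hstep
  show WithLp.ofLp B ⟨castZ b.1, b.2⟩ = 0
  exact hstep.symm

end Terms

/-! ## §3. ★★★ The two-scale Lemma-2.4 inequality on the V1 carriers -/

section Main

variable {j : ℕ}

/-- `Lʲ·L = L^{j+1}`, `L^{j+1} ≥ Lʲ ≥ 1`. [folklore] -/
private theorem pow_facts (j : ℕ) : P.L ^ j * P.L = P.L ^ (j + 1) ∧ 1 ≤ P.L ^ j ∧ P.L ^ j ≤ P.L ^ (j + 1) :=
  ⟨(pow_succ P.L j).symm, Nat.one_le_pow _ _ P.L_pos, Nat.pow_le_pow_right P.L_pos (Nat.le_succ j)⟩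

/-- ★★★ **THE TWO-SCALE LEMMA-2.4 INEQUALITY ON THE FINE TORUS `T^{(0)}` FOR A CONFIGURATION SUPPORTED NEAR A TWO-LEVEL CUBE.**  Data: levels `j, j+1 ≤ m+K`;
label corners `Λs ⊂ Lʲℤ^d` (the cube's blocks of order `j`) and `Λb ⊂ L^{j+1}ℤ^d` (its blocks of order `j+1`) in the fundamental box with a margin of one big block
(`hboxS`, `hboxB`; wrapping cubes go through the torus charts, not here), the two regions disjoint (`hdisj`), every `L^{j+1}`-neighbour of a big block admissible
(`hH`: big ∕ composite ∕ empty — at a cube of the cover this is the separation (2.2)); a bond configuration `B` of `T^{(0)}` SUPPORTED on the bonds of the two regions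
(`hsupp`, in label form) with vanishing staircase sums on every block of the cube (`hTs`, `hTb` — (2.121), C2's tree-gauged class).  Then
`(L^{j+1})^{−(d+1)}·‖B‖² ≤ 12d²(1 + 12d·L^{2j})·( (Lʲ)^{d−2}·Σ_{c ∈ idxS} (Q_jB)(c̄)² + (L^{j+1})^{d−2}·Σ_{C meeting Λb} (Q_{j+1}B)(C̄)² + 2·Σ_p (∂B)(p)² )`
— the `Q`-terms ONLY over the small indices `idxS` (faces of order `j` between blocks not inside big blocks) and the big faces meeting `Λb` (the interface among them).
Transport of `B6Lemma24TwoScale.lemma24_twoScale` along the restricted lift. [cite: Balaban1984PropagatorsII, Lemma 2.4 (2.128) p.245, (2.89) p.239, (2.121) p.244; Balaban1984PropagatorsI, (1.18) p.20] -/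
theorem lemma24_twoLevel_V1 (hd : 2 ≤ P.d) (hj : j + 1 ≤ P.m + P.K) {Λs Λb : Finset (Fin P.d → ℤ)}
    (hΛs : ∀ y ∈ Λs, ∀ i, ((P.L ^ j : ℕ) : ℤ) ∣ y i) (hΛb : ∀ Y ∈ Λb, ∀ i, ((P.L ^ (j + 1) : ℕ) : ℤ) ∣ Y i)
    (hboxS : ∀ y ∈ Λs, ∀ i, ((P.L ^ (j + 1) : ℕ) : ℤ) ≤ y i ∧ y i + ((P.L ^ j : ℕ) : ℤ) + ((P.L ^ (j + 1) : ℕ) : ℤ) ≤ ((P.sitesPerDir 0 : ℕ) : ℤ))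
    (hboxB : ∀ Y ∈ Λb, ∀ i, ((P.L ^ (j + 1) : ℕ) : ℤ) ≤ Y i ∧ Y i + 2 * ((P.L ^ (j + 1) : ℕ) : ℤ) ≤ ((P.sitesPerDir 0 : ℕ) : ℤ))
    (hdisj : ∀ y ∈ Λs, corner (P.L ^ j * P.L) y ∉ Λb)
    (hH : ∀ Y ∈ Λb, ∀ μ : Fin P.d, Adm (P.L ^ j) P.L Λs Λb (Y + ((P.L ^ j * P.L : ℕ) : ℤ) • unitVec μ) ∧
      Adm (P.L ^ j) P.L Λs Λb (Y - ((P.L ^ j * P.L : ℕ) : ℤ) • unitVec μ))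
    (B : BondSpace P)
    (hsupp : ∀ z ∈ pbox (periodV1 P), ∀ μ : Fin P.d, (z, μ) ∉ bonds₂ (P.L ^ j) P.L Λs Λb → WithLp.ofLp B ⟨castZ z, μ⟩ = 0)
    (hTs : ∀ y ∈ Λs, ∀ x ∈ iterBlock j (labSite j y), stairSum (WithLp.ofLp B) (cornerV1 j (labSite j y)) x = 0)
    (hTb : ∀ Y ∈ Λb, ∀ x ∈ iterBlock (j + 1) (labSite (j + 1) Y), stairSum (WithLp.ofLp B) (cornerV1 (j + 1) (labSite (j + 1) Y)) x = 0) :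
    (((P.L : ℝ) ^ (j + 1)) ^ (P.d + 1))⁻¹ * ‖B‖ ^ 2 ≤
      12 * (P.d : ℝ) ^ 2 * (1 + 12 * (P.d : ℝ) * ((P.L : ℝ) ^ j) ^ 2) *
        (((P.L : ℝ) ^ j) ^ (P.d - 2) * ∑ c ∈ idxS (P.L ^ j) P.L Λs Λb, bondAvgIter j (WithLp.ofLp B) (labBond j c) ^ 2 +
          ((P.L : ℝ) ^ (j + 1)) ^ (P.d - 2) * ∑ C ∈ coarseBonds (P.L ^ (j + 1)) Λb, bondAvgIter (j + 1) (WithLp.ofLp B) (labBond (j + 1) C) ^ 2 +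
          2 * ∑ p : Plaq P 0, LatticeFieldCalculus.curl 1 (WithLp.ofLp B) p ^ 2) := by
  obtain ⟨hNn, hn1, hnN⟩ := pow_facts (P := P) j
  have hj0 : j ≤ P.m + P.K := le_trans (Nat.le_succ j) hj
  have hL1 : 1 ≤ P.L := P.L_pos
  have hN1 : 1 ≤ P.L ^ (j + 1) := Nat.one_le_pow _ _ P.L_pos
  set n : ℕ := P.L ^ j with hndef
  set N : ℕ := P.L ^ (j + 1) with hNdef
  set X : Cfg P.d := liftR n P.L Λs Λb B with hXdef
  -- the hypotheses of the ℤᵈ lemma for the restricted lift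
  have hΛb' : ∀ Y ∈ Λb, ∀ i, ((n * P.L : ℕ) : ℤ) ∣ Y i := by rw [hNn]; exact hΛb
  have hB0 : ∀ b, b ∉ bonds₂ n P.L Λs Λb → X b = 0 := fun b hb => liftR_of_not_mem hb
  have hn1Z : (1 : ℤ) ≤ ((n : ℕ) : ℤ) := Int.ofNat_le.mpr hn1
  have hN1Z : (1 : ℤ) ≤ ((N : ℕ) : ℤ) := Int.ofNat_le.mpr hN1
  have hnNZ : ((n : ℕ) : ℤ) ≤ ((N : ℕ) : ℤ) := Int.ofNat_le.mpr hnN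
  have hcsS : ∀ y ∈ Λs, y ∈ coarseSites (P.L ^ j) (periodV1 P) := fun y hy =>
    mem_coarseSites.2 ⟨mem_pbox.2 fun i => ⟨by have := (hboxS y hy i).1; omega, by
      show y i < ((P.sitesPerDir 0 : ℕ) : ℤ); have := (hboxS y hy i).2; omega⟩, hΛs y hy⟩
  have hcsB : ∀ Y ∈ Λb, Y ∈ coarseSites (P.L ^ (j + 1)) (periodV1 P) := fun Y hY =>
    mem_coarseSites.2 ⟨mem_pbox.2 fun i => ⟨by have := (hboxB Y hY i).1; omega, by
      show Y i < ((P.sitesPerDir 0 : ℕ) : ℤ); have := (hboxB Y hY i).2; omega⟩, hΛb Y hY⟩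
  have hTs' : ∀ y ∈ Λs, ∀ b ∈ treeBonds n y, X b = 0 := by
    intro y hy b hb
    have hbU : b ∈ bonds₂ n P.L Λs Λb :=
      mem_union_left _ (mem_lamBonds.2 (Or.inl (mem_lam.2 ⟨y, hy, (mem_treeBonds.1 hb).1⟩)))
    rw [hXdef, liftR_of_mem hbU]
    have h := liftB_eq_zero_of_treeBond_at hj0 B (labSite j y) (hTs y hy)
    rw [toZ_cornerV1_labSite hj0 (hcsS y hy)] at h
    exact h b hb
  have hTb' : ∀ Y ∈ Λb, ∀ b ∈ treeBonds (n * P.L) Y, X b = 0 := by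
    intro Y hY b hb
    rw [hNn] at hb
    have hbU : b ∈ bonds₂ n P.L Λs Λb := by
      refine mem_union_right _ (mem_lamBonds.2 (Or.inl (mem_lam.2 ⟨Y, hY, ?_⟩)))
      rw [hNn]; exact (mem_treeBonds.1 hb).1
    rw [hXdef, liftR_of_mem hbU]
    have h := liftB_eq_zero_of_treeBond_at hj B (labSite (j + 1) Y) (hTb Y hY)
    rw [toZ_cornerV1_labSite hj (hcsB Y hY)] at h
    exact h b hb
  -- the ℤᵈ two-scale letter
  have h := lemma24_twoScale hd hn1 hL1 hΛs hΛb' hdisj hH X hB0 hTs' hTb'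
  rw [hNn] at h
  -- the four terms
  have hU : ∀ b ∈ bonds₂ n P.L Λs Λb, b.1 ∈ pbox (periodV1 P) := by
    intro b hb
    rcases mem_union.1 hb with hb | hb
    · rcases mem_lamBonds.1 hb with h1 | h1
      · obtain ⟨y, hy, hby⟩ := mem_lam.1 h1
        refine mem_pbox.2 fun i => ?_
        obtain ⟨a1, a2⟩ := B6Elimination.mem_block.1 hby i
        have := hboxS y hy i
        exact ⟨by omega, by show b.1 i < ((P.sitesPerDir 0 : ℕ) : ℤ); omega⟩
      · obtain ⟨y, hy, hby⟩ := mem_lam.1 h1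
        refine mem_pbox.2 fun i => ?_
        obtain ⟨a1, a2⟩ := B6Elimination.mem_block.1 hby i
        have := hboxS y hy i
        rw [add_unitVec_apply] at a1 a2
        constructor
        · split_ifs at a1 <;> omega
        · show b.1 i < ((P.sitesPerDir 0 : ℕ) : ℤ); split_ifs at a2 <;> omega
    · rw [hNn] at hb
      rcases mem_lamBonds.1 hb with h1 | h1
      · obtain ⟨Y, hY, hbY⟩ := mem_lam.1 h1
        refine mem_pbox.2 fun i => ?_
        obtain ⟨a1, a2⟩ := B6Elimination.mem_block.1 hbY i
        have := hboxB Y hY i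
        exact ⟨by omega, by show b.1 i < ((P.sitesPerDir 0 : ℕ) : ℤ); omega⟩
      · obtain ⟨Y, hY, hbY⟩ := mem_lam.1 h1
        refine mem_pbox.2 fun i => ?_
        obtain ⟨a1, a2⟩ := B6Elimination.mem_block.1 hbY i
        have := hboxB Y hY i
        rw [add_unitVec_apply] at a1 a2
        constructor
        · split_ifs at a1 <;> omega
        · show b.1 i < ((P.sitesPerDir 0 : ℕ) : ℤ); split_ifs at a2 <;> omega
  have hNrm : normSq₂ n P.L Λs Λb X = ‖B‖ ^ 2 := normSq₂_liftR hsupp hU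
  have hQS : ∑ c ∈ idxS n P.L Λs Λb, q1Term n X c = ∑ c ∈ idxS n P.L Λs Λb, bondAvgIter j (WithLp.ofLp B) (labBond j c) ^ 2 := by
    refine sum_congr rfl fun c hc => q1Term_liftR_eq hj0 hsupp ?_ ?_
    · have hcb := idxS_subset Λs Λb hc
      refine mem_coarseSites.2 ⟨mem_pbox.2 fun i => ?_, dvd_of_mem_coarseBonds hΛs hcb⟩
      rcases mem_coarseBonds.1 hcb with h1 | h1
      · exact mem_pbox.1 (mem_coarseSites.1 (hcsS _ h1)).1 i
      · have := hboxS _ h1 i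
        rw [add_smul_unitVec_apply] at this
        constructor
        · split_ifs at this <;> omega
        · show c.1 i < ((P.sitesPerDir 0 : ℕ) : ℤ); split_ifs at this <;> omega
    · intro i
      have hcb := idxS_subset Λs Λb hc
      show c.1 i + 2 * ((n : ℕ) : ℤ) ≤ ((P.sitesPerDir 0 : ℕ) : ℤ)
      rcases mem_coarseBonds.1 hcb with h1 | h1
      · have := (hboxS _ h1 i).2; omega
      · have := (hboxS _ h1 i).2
        rw [add_smul_unitVec_apply] at this
        split_ifs at this <;> omega
  have hQB : q1Of (P.L ^ (j + 1)) Λb X = ∑ C ∈ coarseBonds (P.L ^ (j + 1)) Λb, bondAvgIter (j + 1) (WithLp.ofLp B) (labBond (j + 1) C) ^ 2 := by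
    rw [q1Of]
    refine sum_congr rfl fun C hC => q1Term_liftR_eq hj hsupp ?_ ?_
    · refine mem_coarseSites.2 ⟨mem_pbox.2 fun i => ?_, dvd_of_mem_coarseBonds hΛb hC⟩
      rcases mem_coarseBonds.1 hC with h1 | h1
      · exact mem_pbox.1 (mem_coarseSites.1 (hcsB _ h1)).1 i
      · have := hboxB _ h1 i
        rw [add_smul_unitVec_apply] at this
        constructor
        · split_ifs at this <;> omega
        · show C.1 i < ((P.sitesPerDir 0 : ℕ) : ℤ); split_ifs at this <;> omega
    · intro i
      show C.1 i + 2 * ((N : ℕ) : ℤ) ≤ ((P.sitesPerDir 0 : ℕ) : ℤ)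
      rcases mem_coarseBonds.1 hC with h1 | h1
      · have := (hboxB _ h1 i).2; omega
      · have := (hboxB _ h1 i).2
        rw [add_smul_unitVec_apply] at this
        split_ifs at this <;> omega
  have hPS : d1Sq n Λs X ≤ ∑ p : Plaq P 0, LatticeFieldCalculus.curl 1 (WithLp.ofLp B) p ^ 2 := by
    refine d1Sq_liftR_le hsupp fun y hy i => ?_
    have := hboxS y hy i
    show 1 ≤ y i ∧ y i + ((n : ℕ) : ℤ) + 1 ≤ ((P.sitesPerDir 0 : ℕ) : ℤ)
    constructor <;> omega
  have hPB : d1Sq (P.L ^ (j + 1)) Λb X ≤ ∑ p : Plaq P 0, LatticeFieldCalculus.curl 1 (WithLp.ofLp B) p ^ 2 := by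
    refine d1Sq_liftR_le hsupp fun Y hY i => ?_
    have := hboxB Y hY i
    show 1 ≤ Y i ∧ Y i + ((N : ℕ) : ℤ) + 1 ≤ ((P.sitesPerDir 0 : ℕ) : ℤ)
    constructor <;> omega
  -- assemble
  rw [hNrm, hQS, hQB] at h
  have hK0 : (0 : ℝ) ≤ 12 * (P.d : ℝ) ^ 2 * (1 + 12 * (P.d : ℝ) * ((n : ℕ) : ℝ) ^ 2) := by positivity
  have h2 := h.trans (mul_le_mul_of_nonneg_left (add_le_add (add_le_add le_rfl hPS) hPB) hK0)
  have en : ((P.L : ℝ) ^ j) = ((n : ℕ) : ℝ) := by rw [hndef, Nat.cast_pow]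
  have eN : ((P.L : ℝ) ^ (j + 1)) = ((N : ℕ) : ℝ) := by rw [hNdef, Nat.cast_pow]
  rw [en, eN, ← inv_pow]
  refine h2.trans (le_of_eq ?_)
  ring

/-- ★ **the support hypothesis from a torus-side support statement**: if every bond carrying `B` has an end point whose labels lie in the two regions, and the regions
keep one lattice unit off the lower box boundary, then `B` vanishes on every torus bond whose label representative is not a bond of the two regions (the `hsupp` of
`lemma24_twoLevel_V1`). [cite: Balaban1984PropagatorsII, Lemma 2.4 p.245 («at least one of the end-points b₋, b₊ belongs to Λ»); folklore] -/
theorem supp_of_torusSupport {n L : ℕ} {Λs Λb : Finset (Fin P.d → ℤ)} (hU1 : ∀ u ∈ lam n Λs ∪ lam (n * L) Λb, ∀ i, 1 ≤ u i) (B : BondSpace P)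
    (hB : ∀ b : PBond P 0, WithLp.ofLp B b ≠ 0 → toZ b.src ∈ lam n Λs ∪ lam (n * L) Λb ∨ toZ (b.src.shift b.dir) ∈ lam n Λs ∪ lam (n * L) Λb) :
    ∀ z ∈ pbox (periodV1 P), ∀ μ : Fin P.d, (z, μ) ∉ bonds₂ n L Λs Λb → WithLp.ofLp B ⟨castZ z, μ⟩ = 0 := by
  intro z hz μ hnot
  by_contra hne
  have mem_of : ∀ w, w ∈ lam n Λs ∪ lam (n * L) Λb → ∀ ν, (w, ν) ∈ bonds₂ n L Λs Λb ∧ (w - unitVec ν, ν) ∈ bonds₂ n L Λs Λb := by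
    intro w hw ν
    rcases mem_union.1 hw with hw | hw
    · exact ⟨mem_union_left _ (mem_lamBonds.2 (Or.inl hw)), mem_union_left _ (mem_lamBonds.2 (Or.inr (by rw [sub_add_cancel]; exact hw)))⟩
    · exact ⟨mem_union_right _ (mem_lamBonds.2 (Or.inl hw)), mem_union_right _ (mem_lamBonds.2 (Or.inr (by rw [sub_add_cancel]; exact hw)))⟩
  rcases hB ⟨castZ z, μ⟩ hne with h | h
  · rw [toZ_castZ_of_mem_pbox hz] at h
    exact hnot (mem_of z h μ).1
  · rw [show (castZ z : Site P 0).shift μ = castZ (z + unitVec μ) from (castZ_add_unitVec z μ).symm] at h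
    by_cases hz' : z + unitVec μ ∈ pbox (periodV1 P)
    · rw [toZ_castZ_of_mem_pbox hz'] at h
      have := (mem_of _ h μ).2
      rw [add_sub_cancel_right] at this
      exact hnot this
    · -- the step leaves the box: the wrapped label has `μ`-coordinate `0`, impossible in the regions
      have hzμ : z μ + 1 = ((P.sitesPerDir 0 : ℕ) : ℤ) := by
        obtain ⟨h0, h1⟩ := mem_pbox.1 hz μ
        have hper : ((periodV1 P μ : ℕ) : ℤ) = ((P.sitesPerDir 0 : ℕ) : ℤ) := rfl
        rw [hper] at h1
        by_contra hc
        apply hz'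
        refine mem_pbox.2 fun i => ?_
        obtain ⟨a0, a1⟩ := mem_pbox.1 hz i
        rw [add_unitVec_apply]
        by_cases hi : i = μ
        · rw [if_pos hi, hi]
          exact ⟨by omega, by show z μ + 1 < ((P.sitesPerDir 0 : ℕ) : ℤ); omega⟩
        · rw [if_neg hi, add_zero]; exact ⟨a0, a1⟩
      have hval : toZ (castZ (P := P) (z + unitVec μ)) μ = 0 := by
        have e : (z + unitVec μ) μ = ((P.sitesPerDir 0 : ℕ) : ℤ) := by rw [add_unitVec_apply, if_pos rfl, hzμ]
        simp only [B6SectALemma24OneLevelV1.toZ, B6SectALemma24OneLevelV1.castZ, e, Int.cast_natCast, ZMod.natCast_self, ZMod.val_zero,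
          Nat.cast_zero]
      have := hU1 _ h μ
      rw [hval] at this
      exact absurd this (by norm_num)

end Main

/-! ## §4. ★★★ The Lemma-2.4 letter of C1 for the interface cubes -/

section Letter

variable {j : ℕ}

/-- the weighted averaging term of `Δ_a` dominates `w₀·(Σ_{c∈S}(Q_jB)(c̄)² + Σ_{C∈T}(Q_{j+1}B)(C̄)²)` when the label bonds of `S` (order `j`) and `T` (order `j+1`) are INDICES of `𝔅`
(two injections into `𝔅` with disjoint images — different levels). [cite: Balaban1984PropagatorsII, (2.3) p.224, (2.18)–(2.20) p.226] -/
theorem sum_weight_QE_twoLevel_ge (D : Domains P) (hjk : j + 1 ≤ D.k) {w : BondIdx D → ℝ} {w₀ : ℝ} (hw₀ : 0 ≤ w₀) (hw : ∀ i, w₀ ≤ w i)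
    {S T : Finset ((Fin P.d → ℤ) × Fin P.d)} (hS : ∀ c ∈ S, c.1 ∈ coarseSites (P.L ^ j) (periodV1 P))
    (hT : ∀ C ∈ T, C.1 ∈ coarseSites (P.L ^ (j + 1)) (periodV1 P))
    (hIS : ∀ c ∈ S, D.LamBond j (labBond j c)) (hIT : ∀ C ∈ T, D.LamBond (j + 1) (labBond (j + 1) C)) (B : BondSpace P) :
    w₀ * (∑ c ∈ S, bondAvgIter j (WithLp.ofLp B) (labBond j c) ^ 2 + ∑ C ∈ T, bondAvgIter (j + 1) (WithLp.ofLp B) (labBond (j + 1) C) ^ 2) ≤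
      ∑ i, w i * QE D B i ^ 2 := by
  classical
  have hjD : j < D.k + 1 := by omega
  have hj1D : j + 1 < D.k + 1 := by omega
  -- the two index maps
  let φ : {c // c ∈ S} → BondIdx D := fun c => ⟨⟨⟨j, hjD⟩, labBond j c.1⟩, hIS c.1 c.2⟩
  let ψ : {C // C ∈ T} → BondIdx D := fun C => ⟨⟨⟨j + 1, hj1D⟩, labBond (j + 1) C.1⟩, hIT C.1 C.2⟩
  have hφ : Function.Injective φ := by
    intro c c' h
    have h1 : labBond (P := P) j c.1 = labBond j c'.1 := by
      have := congrArg (fun i : BondIdx D => i.1) h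
      simp only [φ, Sigma.mk.inj_iff, heq_eq_eq, true_and] at this
      exact this
    exact Subtype.ext (labBond_injOn (le_trans (by omega) D.hk) hS c.2 c'.2 h1)
  have hψ : Function.Injective ψ := by
    intro C C' h
    have h1 : labBond (P := P) (j + 1) C.1 = labBond (j + 1) C'.1 := by
      have := congrArg (fun i : BondIdx D => i.1) h
      simp only [ψ, Sigma.mk.inj_iff, heq_eq_eq, true_and] at this
      exact this
    exact Subtype.ext (labBond_injOn (le_trans hjk D.hk) hT C.2 C'.2 h1)
  have hdisj : Disjoint (univ.map ⟨φ, hφ⟩) (univ.map ⟨ψ, hψ⟩) := by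
    refine disjoint_left.2 fun i hi hi' => ?_
    obtain ⟨c, -, rfl⟩ := mem_map.1 hi
    obtain ⟨C, -, hC⟩ := mem_map.1 hi'
    have := congrArg (fun i : BondIdx D => (i.1.1 : ℕ)) hC
    simp only [φ, ψ, Function.Embedding.coeFn_mk] at this
    omega
  have hS' : w₀ * ∑ c ∈ S, bondAvgIter j (WithLp.ofLp B) (labBond j c) ^ 2 ≤ ∑ i ∈ univ.map ⟨φ, hφ⟩, w i * QE D B i ^ 2 := by
    rw [sum_map, mul_sum, ← sum_coe_sort S]
    exact sum_le_sum fun c _ => mul_le_mul_of_nonneg_right (hw _) (sq_nonneg _)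
  have hT' : w₀ * ∑ C ∈ T, bondAvgIter (j + 1) (WithLp.ofLp B) (labBond (j + 1) C) ^ 2 ≤ ∑ i ∈ univ.map ⟨ψ, hψ⟩, w i * QE D B i ^ 2 := by
    rw [sum_map, mul_sum, ← sum_coe_sort T]
    exact sum_le_sum fun C _ => mul_le_mul_of_nonneg_right (hw _) (sq_nonneg _)
  calc w₀ * (∑ c ∈ S, bondAvgIter j (WithLp.ofLp B) (labBond j c) ^ 2 + ∑ C ∈ T, bondAvgIter (j + 1) (WithLp.ofLp B) (labBond (j + 1) C) ^ 2)
      ≤ ∑ i ∈ univ.map ⟨φ, hφ⟩, w i * QE D B i ^ 2 + ∑ i ∈ univ.map ⟨ψ, hψ⟩, w i * QE D B i ^ 2 := by rw [mul_add]; exact add_le_add hS' hT'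
    _ = ∑ i ∈ univ.map ⟨φ, hφ⟩ ∪ univ.map ⟨ψ, hψ⟩, w i * QE D B i ^ 2 := (sum_union hdisj).symm
    _ ≤ ∑ i, w i * QE D B i ^ 2 := sum_le_sum_of_subset_of_nonneg (subset_univ _) fun i _ _ => mul_nonneg (hw₀.trans (hw i)) (sq_nonneg _)

/-- ★★★ **THE LEMMA-2.4 LETTER OF C1 FOR A CUBE MEETING `Ω_{j+1}`** (the `hL24` hypothesis of `B6SectADeltaACoerciveReductionV1.deltaAE_coercive_of_treeGauge_letters'` for the
configurations of the local-cube road supported near a two-level cube).  Data as in `lemma24_twoLevel_V1`, a nested family `D` with `j + 1 ≤ k`, the small label faces of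
`idxS` being INDICES at level `j` and the big label faces meeting `Λb` being indices at level `j + 1` (`hIS`, `hIB` — at a cube of the cover: r03's `LamBond`, neither end
point deep), weights `w ≥ w₀ ≥ 0`: **`κ·‖B‖² ≤ ‖∂B‖² + Σ_𝔅 w·(QB)²`** with
`κ = (12d²(1 + 12d·L^{2j}))⁻¹·((L^{j+1})^{d+1})⁻¹·min(c²/2, w₀/(L^{j+1})^{d−2})` — explicit, volume-free, level-dependent.
[cite: Balaban1984PropagatorsII, Lemma 2.4 (2.128) p.245, (2.19) p.226, (2.89) p.239, (2.121) p.244] -/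
theorem lemma24_letter_twoLevel (hd : 2 ≤ P.d) (D : Domains P) (hjk : j + 1 ≤ D.k) {Λs Λb : Finset (Fin P.d → ℤ)}
    (hΛs : ∀ y ∈ Λs, ∀ i, ((P.L ^ j : ℕ) : ℤ) ∣ y i) (hΛb : ∀ Y ∈ Λb, ∀ i, ((P.L ^ (j + 1) : ℕ) : ℤ) ∣ Y i)
    (hboxS : ∀ y ∈ Λs, ∀ i, ((P.L ^ (j + 1) : ℕ) : ℤ) ≤ y i ∧ y i + ((P.L ^ j : ℕ) : ℤ) + ((P.L ^ (j + 1) : ℕ) : ℤ) ≤ ((P.sitesPerDir 0 : ℕ) : ℤ))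
    (hboxB : ∀ Y ∈ Λb, ∀ i, ((P.L ^ (j + 1) : ℕ) : ℤ) ≤ Y i ∧ Y i + 2 * ((P.L ^ (j + 1) : ℕ) : ℤ) ≤ ((P.sitesPerDir 0 : ℕ) : ℤ))
    (hdisj : ∀ y ∈ Λs, corner (P.L ^ j * P.L) y ∉ Λb)
    (hH : ∀ Y ∈ Λb, ∀ μ : Fin P.d, Adm (P.L ^ j) P.L Λs Λb (Y + ((P.L ^ j * P.L : ℕ) : ℤ) • unitVec μ) ∧
      Adm (P.L ^ j) P.L Λs Λb (Y - ((P.L ^ j * P.L : ℕ) : ℤ) • unitVec μ))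
    (hIS : ∀ c ∈ idxS (P.L ^ j) P.L Λs Λb, D.LamBond j (labBond j c))
    (hIB : ∀ C ∈ coarseBonds (P.L ^ (j + 1)) Λb, D.LamBond (j + 1) (labBond (j + 1) C))
    (c : ℝ) {w : BondIdx D → ℝ} {w₀ : ℝ} (hw₀ : 0 ≤ w₀) (hw : ∀ i, w₀ ≤ w i) (B : BondSpace P)
    (hsupp : ∀ z ∈ pbox (periodV1 P), ∀ μ : Fin P.d, (z, μ) ∉ bonds₂ (P.L ^ j) P.L Λs Λb → WithLp.ofLp B ⟨castZ z, μ⟩ = 0)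
    (hTs : ∀ y ∈ Λs, ∀ x ∈ iterBlock j (labSite j y), stairSum (WithLp.ofLp B) (cornerV1 j (labSite j y)) x = 0)
    (hTb : ∀ Y ∈ Λb, ∀ x ∈ iterBlock (j + 1) (labSite (j + 1) Y), stairSum (WithLp.ofLp B) (cornerV1 (j + 1) (labSite (j + 1) Y)) x = 0) :
    (12 * (P.d : ℝ) ^ 2 * (1 + 12 * (P.d : ℝ) * ((P.L : ℝ) ^ j) ^ 2))⁻¹ * (((P.L : ℝ) ^ (j + 1)) ^ (P.d + 1))⁻¹ *
        min (c ^ 2 / 2) (w₀ / ((P.L : ℝ) ^ (j + 1)) ^ (P.d - 2)) * ‖B‖ ^ 2 ≤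
      ‖dcE c B‖ ^ 2 + ∑ i, w i * QE D B i ^ 2 := by
  have hj : j + 1 ≤ P.m + P.K := le_trans hjk D.hk
  have h24 := lemma24_twoLevel_V1 hd hj hΛs hΛb hboxS hboxB hdisj hH B hsupp hTs hTb
  -- which label faces are coarse sites of the box (for the injectivity of the index maps)
  have hn1 : 1 ≤ P.L ^ j := Nat.one_le_pow _ _ P.L_pos
  have hN1 : 1 ≤ P.L ^ (j + 1) := Nat.one_le_pow _ _ P.L_pos
  have hnN : P.L ^ j ≤ P.L ^ (j + 1) := Nat.pow_le_pow_right P.L_pos (Nat.le_succ j)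
  have hn1Z : (1 : ℤ) ≤ ((P.L ^ j : ℕ) : ℤ) := Int.ofNat_le.mpr hn1
  have hnNZ : ((P.L ^ j : ℕ) : ℤ) ≤ ((P.L ^ (j + 1) : ℕ) : ℤ) := Int.ofNat_le.mpr hnN
  have hS : ∀ c ∈ idxS (P.L ^ j) P.L Λs Λb, c.1 ∈ coarseSites (P.L ^ j) (periodV1 P) := by
    intro c hc
    have hcb := idxS_subset Λs Λb hc
    refine mem_coarseSites.2 ⟨mem_pbox.2 fun i => ?_, dvd_of_mem_coarseBonds hΛs hcb⟩
    show 0 ≤ c.1 i ∧ c.1 i < ((P.sitesPerDir 0 : ℕ) : ℤ)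
    rcases mem_coarseBonds.1 hcb with h1 | h1
    · have := hboxS _ h1 i; constructor <;> omega
    · have := hboxS _ h1 i
      rw [add_smul_unitVec_apply] at this
      split_ifs at this <;> constructor <;> omega
  have hT : ∀ C ∈ coarseBonds (P.L ^ (j + 1)) Λb, C.1 ∈ coarseSites (P.L ^ (j + 1)) (periodV1 P) := by
    intro C hC
    refine mem_coarseSites.2 ⟨mem_pbox.2 fun i => ?_, dvd_of_mem_coarseBonds hΛb hC⟩
    show 0 ≤ C.1 i ∧ C.1 i < ((P.sitesPerDir 0 : ℕ) : ℤ)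
    rcases mem_coarseBonds.1 hC with h1 | h1
    · have := hboxB _ h1 i; constructor <;> omega
    · have := hboxB _ h1 i
      rw [add_smul_unitVec_apply] at this
      split_ifs at this <;> constructor <;> omega
  have hQ := sum_weight_QE_twoLevel_ge D hjk hw₀ hw hS hT hIS hIB B
  -- abbreviations
  set K : ℝ := 12 * (P.d : ℝ) ^ 2 * (1 + 12 * (P.d : ℝ) * ((P.L : ℝ) ^ j) ^ 2) with hK
  set α : ℝ := (((P.L : ℝ) ^ (j + 1)) ^ (P.d + 1))⁻¹ with hα
  set r : ℝ := ((P.L : ℝ) ^ j) ^ (P.d - 2) with hr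
  set R : ℝ := ((P.L : ℝ) ^ (j + 1)) ^ (P.d - 2) with hR
  set QS : ℝ := ∑ c ∈ idxS (P.L ^ j) P.L Λs Λb, bondAvgIter j (WithLp.ofLp B) (labBond j c) ^ 2 with hQS
  set QB : ℝ := ∑ C ∈ coarseBonds (P.L ^ (j + 1)) Λb, bondAvgIter (j + 1) (WithLp.ofLp B) (labBond (j + 1) C) ^ 2 with hQB
  set SC : ℝ := ∑ p : Plaq P 0, LatticeFieldCalculus.curl 1 (WithLp.ofLp B) p ^ 2 with hSC
  set μ : ℝ := min (c ^ 2 / 2) (w₀ / R) with hμ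
  have hL0 : (0 : ℝ) < (P.L : ℝ) := by exact_mod_cast P.L_pos
  have hK0 : 0 < K := by rw [hK]; positivity
  have hR0 : 0 < R := by rw [hR]; positivity
  have hr0 : 0 ≤ r := by rw [hr]; positivity
  have hrR : r ≤ R := by
    rw [hr, hR]
    exact pow_le_pow_left₀ (by positivity) (pow_le_pow_right₀ (by exact_mod_cast P.L_pos) (Nat.le_succ j)) _
  have hQS0 : 0 ≤ QS := sum_nonneg fun _ _ => sq_nonneg _
  have hQB0 : 0 ≤ QB := sum_nonneg fun _ _ => sq_nonneg _
  have hSC0 : 0 ≤ SC := sum_nonneg fun _ _ => sq_nonneg _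
  have hμ0 : 0 ≤ μ := le_min (by positivity) (div_nonneg hw₀ hR0.le)
  -- `μ·(rQ^S + RQ^B + 2Σ_p) ≤ w₀(Q^S + Q^B) + c²Σ_p`
  have h1 : μ * (r * QS) ≤ w₀ * QS := by
    calc μ * (r * QS) ≤ (w₀ / R) * (R * QS) := mul_le_mul (min_le_right _ _) (mul_le_mul_of_nonneg_right hrR hQS0) (by positivity) (div_nonneg hw₀ hR0.le)
      _ = w₀ * QS := by field_simp
  have h2 : μ * (R * QB) ≤ w₀ * QB := by
    calc μ * (R * QB) ≤ (w₀ / R) * (R * QB) := mul_le_mul_of_nonneg_right (min_le_right _ _) (by positivity)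
      _ = w₀ * QB := by field_simp
  have h3 : μ * (2 * SC) ≤ c ^ 2 * SC := by
    calc μ * (2 * SC) ≤ (c ^ 2 / 2) * (2 * SC) := mul_le_mul_of_nonneg_right (min_le_left _ _) (by positivity)
      _ = c ^ 2 * SC := by ring
  have h24' : α * ‖B‖ ^ 2 ≤ K * (r * QS + R * QB + 2 * SC) := h24
  rw [normSq_dcE_eq]
  calc K⁻¹ * α * μ * ‖B‖ ^ 2 = μ * (K⁻¹ * (α * ‖B‖ ^ 2)) := by ring
    _ ≤ μ * (K⁻¹ * (K * (r * QS + R * QB + 2 * SC))) :=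
        mul_le_mul_of_nonneg_left (mul_le_mul_of_nonneg_left h24' (inv_nonneg.2 hK0.le)) hμ0
    _ = μ * (r * QS) + μ * (R * QB) + μ * (2 * SC) := by rw [← mul_assoc K⁻¹, inv_mul_cancel₀ hK0.ne', one_mul]; ring
    _ ≤ w₀ * QS + w₀ * QB + c ^ 2 * SC := add_le_add (add_le_add h1 h2) h3
    _ = w₀ * (QS + QB) + c ^ 2 * SC := by ring
    _ ≤ (∑ i, w i * QE D B i ^ 2) + c ^ 2 * SC := by linarith [hQ]
    _ = c ^ 2 * SC + ∑ i, w i * QE D B i ^ 2 := by ring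

/-- the constant of `lemma24_letter_twoLevel` is positive for `c ≠ 0`, `w₀ > 0`. [cite: Balaban1984PropagatorsII, Lemma 2.4 (2.128) p.245; folklore] -/
theorem lemma24_letter_twoLevel_const_pos (j : ℕ) {c w₀ : ℝ} (hc : c ≠ 0) (hw₀ : 0 < w₀) (hd : 1 ≤ P.d) :
    0 < (12 * (P.d : ℝ) ^ 2 * (1 + 12 * (P.d : ℝ) * ((P.L : ℝ) ^ j) ^ 2))⁻¹ * (((P.L : ℝ) ^ (j + 1)) ^ (P.d + 1))⁻¹ *
        min (c ^ 2 / 2) (w₀ / ((P.L : ℝ) ^ (j + 1)) ^ (P.d - 2)) := by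
  have hL : (0 : ℝ) < (P.L : ℝ) := by exact_mod_cast P.L_pos
  have hd' : (0 : ℝ) < (P.d : ℝ) := by exact_mod_cast hd
  have hmin : 0 < min (c ^ 2 / 2) (w₀ / ((P.L : ℝ) ^ (j + 1)) ^ (P.d - 2)) := lt_min (by positivity) (div_pos hw₀ (by positivity))
  positivity

end Letter

/-! ## §5 (v1.1, append-only). ★★★ The admissibility-free editions -/

section NoAdm

variable {j : ℕ}

/-- ★★★ **THE TWO-SCALE LEMMA-2.4 INEQUALITY ON `T^{(0)}`, ADMISSIBILITY-FREE** — as `lemma24_twoLevel_V1` but WITHOUT the hypothesis `hH` on the `L^{j+1}`-neighbours of the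
big blocks (transport of `B6Lemma24TwoScale.lemma24_twoScale_noAdm`): the cube's level-`j` part need NOT be a union of `(j+1)`-positions (def-Y's `cubeDomY` is a
sup-metric ball on block centres and is not `(j+1)`-aligned at its boundary — bus 2026-08-28T18:20Z — and is admitted here).
[cite: Balaban1984PropagatorsII, Lemma 2.4 (2.128) p.245, (2.89) p.239, (2.121) p.244; Balaban1984PropagatorsI, (1.18) p.20] -/
theorem lemma24_twoLevel_V1_noAdm (hd : 2 ≤ P.d) (hj : j + 1 ≤ P.m + P.K) {Λs Λb : Finset (Fin P.d → ℤ)}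
    (hΛs : ∀ y ∈ Λs, ∀ i, ((P.L ^ j : ℕ) : ℤ) ∣ y i) (hΛb : ∀ Y ∈ Λb, ∀ i, ((P.L ^ (j + 1) : ℕ) : ℤ) ∣ Y i)
    (hboxS : ∀ y ∈ Λs, ∀ i, ((P.L ^ (j + 1) : ℕ) : ℤ) ≤ y i ∧ y i + ((P.L ^ j : ℕ) : ℤ) + ((P.L ^ (j + 1) : ℕ) : ℤ) ≤ ((P.sitesPerDir 0 : ℕ) : ℤ))
    (hboxB : ∀ Y ∈ Λb, ∀ i, ((P.L ^ (j + 1) : ℕ) : ℤ) ≤ Y i ∧ Y i + 2 * ((P.L ^ (j + 1) : ℕ) : ℤ) ≤ ((P.sitesPerDir 0 : ℕ) : ℤ))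
    (hdisj : ∀ y ∈ Λs, corner (P.L ^ j * P.L) y ∉ Λb)
    (B : BondSpace P)
    (hsupp : ∀ z ∈ pbox (periodV1 P), ∀ μ : Fin P.d, (z, μ) ∉ bonds₂ (P.L ^ j) P.L Λs Λb → WithLp.ofLp B ⟨castZ z, μ⟩ = 0)
    (hTs : ∀ y ∈ Λs, ∀ x ∈ iterBlock j (labSite j y), stairSum (WithLp.ofLp B) (cornerV1 j (labSite j y)) x = 0)
    (hTb : ∀ Y ∈ Λb, ∀ x ∈ iterBlock (j + 1) (labSite (j + 1) Y), stairSum (WithLp.ofLp B) (cornerV1 (j + 1) (labSite (j + 1) Y)) x = 0) :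
    (((P.L : ℝ) ^ (j + 1)) ^ (P.d + 1))⁻¹ * ‖B‖ ^ 2 ≤
      12 * (P.d : ℝ) ^ 2 * (1 + 12 * (P.d : ℝ) * ((P.L : ℝ) ^ j) ^ 2) *
        (((P.L : ℝ) ^ j) ^ (P.d - 2) * ∑ c ∈ idxS (P.L ^ j) P.L Λs Λb, bondAvgIter j (WithLp.ofLp B) (labBond j c) ^ 2 +
          ((P.L : ℝ) ^ (j + 1)) ^ (P.d - 2) * ∑ C ∈ coarseBonds (P.L ^ (j + 1)) Λb, bondAvgIter (j + 1) (WithLp.ofLp B) (labBond (j + 1) C) ^ 2 +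
          2 * ∑ p : Plaq P 0, LatticeFieldCalculus.curl 1 (WithLp.ofLp B) p ^ 2) := by
  obtain ⟨hNn, hn1, hnN⟩ := pow_facts (P := P) j
  have hj0 : j ≤ P.m + P.K := le_trans (Nat.le_succ j) hj
  have hL1 : 1 ≤ P.L := P.L_pos
  have hN1 : 1 ≤ P.L ^ (j + 1) := Nat.one_le_pow _ _ P.L_pos
  set n : ℕ := P.L ^ j with hndef
  set N : ℕ := P.L ^ (j + 1) with hNdef
  set X : Cfg P.d := liftR n P.L Λs Λb B with hXdef
  -- the hypotheses of the ℤᵈ lemma for the restricted lift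
  have hΛb' : ∀ Y ∈ Λb, ∀ i, ((n * P.L : ℕ) : ℤ) ∣ Y i := by rw [hNn]; exact hΛb
  have hB0 : ∀ b, b ∉ bonds₂ n P.L Λs Λb → X b = 0 := fun b hb => liftR_of_not_mem hb
  have hn1Z : (1 : ℤ) ≤ ((n : ℕ) : ℤ) := Int.ofNat_le.mpr hn1
  have hN1Z : (1 : ℤ) ≤ ((N : ℕ) : ℤ) := Int.ofNat_le.mpr hN1
  have hnNZ : ((n : ℕ) : ℤ) ≤ ((N : ℕ) : ℤ) := Int.ofNat_le.mpr hnN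
  have hcsS : ∀ y ∈ Λs, y ∈ coarseSites (P.L ^ j) (periodV1 P) := fun y hy =>
    mem_coarseSites.2 ⟨mem_pbox.2 fun i => ⟨by have := (hboxS y hy i).1; omega, by
      show y i < ((P.sitesPerDir 0 : ℕ) : ℤ); have := (hboxS y hy i).2; omega⟩, hΛs y hy⟩
  have hcsB : ∀ Y ∈ Λb, Y ∈ coarseSites (P.L ^ (j + 1)) (periodV1 P) := fun Y hY =>
    mem_coarseSites.2 ⟨mem_pbox.2 fun i => ⟨by have := (hboxB Y hY i).1; omega, by
      show Y i < ((P.sitesPerDir 0 : ℕ) : ℤ); have := (hboxB Y hY i).2; omega⟩, hΛb Y hY⟩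
  have hTs' : ∀ y ∈ Λs, ∀ b ∈ treeBonds n y, X b = 0 := by
    intro y hy b hb
    have hbU : b ∈ bonds₂ n P.L Λs Λb :=
      mem_union_left _ (mem_lamBonds.2 (Or.inl (mem_lam.2 ⟨y, hy, (mem_treeBonds.1 hb).1⟩)))
    rw [hXdef, liftR_of_mem hbU]
    have h := liftB_eq_zero_of_treeBond_at hj0 B (labSite j y) (hTs y hy)
    rw [toZ_cornerV1_labSite hj0 (hcsS y hy)] at h
    exact h b hb
  have hTb' : ∀ Y ∈ Λb, ∀ b ∈ treeBonds (n * P.L) Y, X b = 0 := by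
    intro Y hY b hb
    rw [hNn] at hb
    have hbU : b ∈ bonds₂ n P.L Λs Λb := by
      refine mem_union_right _ (mem_lamBonds.2 (Or.inl (mem_lam.2 ⟨Y, hY, ?_⟩)))
      rw [hNn]; exact (mem_treeBonds.1 hb).1
    rw [hXdef, liftR_of_mem hbU]
    have h := liftB_eq_zero_of_treeBond_at hj B (labSite (j + 1) Y) (hTb Y hY)
    rw [toZ_cornerV1_labSite hj (hcsB Y hY)] at h
    exact h b hb
  -- the ℤᵈ two-scale letter
  have h := B6Lemma24TwoScale.lemma24_twoScale_noAdm hd hn1 hL1 hΛs hΛb' hdisj X hB0 hTs' hTb'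
  rw [hNn] at h
  -- the four terms
  have hU : ∀ b ∈ bonds₂ n P.L Λs Λb, b.1 ∈ pbox (periodV1 P) := by
    intro b hb
    rcases mem_union.1 hb with hb | hb
    · rcases mem_lamBonds.1 hb with h1 | h1
      · obtain ⟨y, hy, hby⟩ := mem_lam.1 h1
        refine mem_pbox.2 fun i => ?_
        obtain ⟨a1, a2⟩ := B6Elimination.mem_block.1 hby i
        have := hboxS y hy i
        exact ⟨by omega, by show b.1 i < ((P.sitesPerDir 0 : ℕ) : ℤ); omega⟩
      · obtain ⟨y, hy, hby⟩ := mem_lam.1 h1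
        refine mem_pbox.2 fun i => ?_
        obtain ⟨a1, a2⟩ := B6Elimination.mem_block.1 hby i
        have := hboxS y hy i
        rw [add_unitVec_apply] at a1 a2
        constructor
        · split_ifs at a1 <;> omega
        · show b.1 i < ((P.sitesPerDir 0 : ℕ) : ℤ); split_ifs at a2 <;> omega
    · rw [hNn] at hb
      rcases mem_lamBonds.1 hb with h1 | h1
      · obtain ⟨Y, hY, hbY⟩ := mem_lam.1 h1
        refine mem_pbox.2 fun i => ?_
        obtain ⟨a1, a2⟩ := B6Elimination.mem_block.1 hbY i
        have := hboxB Y hY i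
        exact ⟨by omega, by show b.1 i < ((P.sitesPerDir 0 : ℕ) : ℤ); omega⟩
      · obtain ⟨Y, hY, hbY⟩ := mem_lam.1 h1
        refine mem_pbox.2 fun i => ?_
        obtain ⟨a1, a2⟩ := B6Elimination.mem_block.1 hbY i
        have := hboxB Y hY i
        rw [add_unitVec_apply] at a1 a2
        constructor
        · split_ifs at a1 <;> omega
        · show b.1 i < ((P.sitesPerDir 0 : ℕ) : ℤ); split_ifs at a2 <;> omega
  have hNrm : normSq₂ n P.L Λs Λb X = ‖B‖ ^ 2 := normSq₂_liftR hsupp hU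
  have hQS : ∑ c ∈ idxS n P.L Λs Λb, q1Term n X c = ∑ c ∈ idxS n P.L Λs Λb, bondAvgIter j (WithLp.ofLp B) (labBond j c) ^ 2 := by
    refine sum_congr rfl fun c hc => q1Term_liftR_eq hj0 hsupp ?_ ?_
    · have hcb := idxS_subset Λs Λb hc
      refine mem_coarseSites.2 ⟨mem_pbox.2 fun i => ?_, dvd_of_mem_coarseBonds hΛs hcb⟩
      rcases mem_coarseBonds.1 hcb with h1 | h1
      · exact mem_pbox.1 (mem_coarseSites.1 (hcsS _ h1)).1 i
      · have := hboxS _ h1 i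
        rw [add_smul_unitVec_apply] at this
        constructor
        · split_ifs at this <;> omega
        · show c.1 i < ((P.sitesPerDir 0 : ℕ) : ℤ); split_ifs at this <;> omega
    · intro i
      have hcb := idxS_subset Λs Λb hc
      show c.1 i + 2 * ((n : ℕ) : ℤ) ≤ ((P.sitesPerDir 0 : ℕ) : ℤ)
      rcases mem_coarseBonds.1 hcb with h1 | h1
      · have := (hboxS _ h1 i).2; omega
      · have := (hboxS _ h1 i).2
        rw [add_smul_unitVec_apply] at this
        split_ifs at this <;> omega
  have hQB : q1Of (P.L ^ (j + 1)) Λb X = ∑ C ∈ coarseBonds (P.L ^ (j + 1)) Λb, bondAvgIter (j + 1) (WithLp.ofLp B) (labBond (j + 1) C) ^ 2 := by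
    rw [q1Of]
    refine sum_congr rfl fun C hC => q1Term_liftR_eq hj hsupp ?_ ?_
    · refine mem_coarseSites.2 ⟨mem_pbox.2 fun i => ?_, dvd_of_mem_coarseBonds hΛb hC⟩
      rcases mem_coarseBonds.1 hC with h1 | h1
      · exact mem_pbox.1 (mem_coarseSites.1 (hcsB _ h1)).1 i
      · have := hboxB _ h1 i
        rw [add_smul_unitVec_apply] at this
        constructor
        · split_ifs at this <;> omega
        · show C.1 i < ((P.sitesPerDir 0 : ℕ) : ℤ); split_ifs at this <;> omega
    · intro i
      show C.1 i + 2 * ((N : ℕ) : ℤ) ≤ ((P.sitesPerDir 0 : ℕ) : ℤ)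
      rcases mem_coarseBonds.1 hC with h1 | h1
      · have := (hboxB _ h1 i).2; omega
      · have := (hboxB _ h1 i).2
        rw [add_smul_unitVec_apply] at this
        split_ifs at this <;> omega
  have hPS : d1Sq n Λs X ≤ ∑ p : Plaq P 0, LatticeFieldCalculus.curl 1 (WithLp.ofLp B) p ^ 2 := by
    refine d1Sq_liftR_le hsupp fun y hy i => ?_
    have := hboxS y hy i
    show 1 ≤ y i ∧ y i + ((n : ℕ) : ℤ) + 1 ≤ ((P.sitesPerDir 0 : ℕ) : ℤ)
    constructor <;> omega
  have hPB : d1Sq (P.L ^ (j + 1)) Λb X ≤ ∑ p : Plaq P 0, LatticeFieldCalculus.curl 1 (WithLp.ofLp B) p ^ 2 := by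
    refine d1Sq_liftR_le hsupp fun Y hY i => ?_
    have := hboxB Y hY i
    show 1 ≤ Y i ∧ Y i + ((N : ℕ) : ℤ) + 1 ≤ ((P.sitesPerDir 0 : ℕ) : ℤ)
    constructor <;> omega
  -- assemble
  rw [hNrm, hQS, hQB] at h
  have hK0 : (0 : ℝ) ≤ 12 * (P.d : ℝ) ^ 2 * (1 + 12 * (P.d : ℝ) * ((n : ℕ) : ℝ) ^ 2) := by positivity
  have h2 := h.trans (mul_le_mul_of_nonneg_left (add_le_add (add_le_add le_rfl hPS) hPB) hK0)
  have en : ((P.L : ℝ) ^ j) = ((n : ℕ) : ℝ) := by rw [hndef, Nat.cast_pow]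
  have eN : ((P.L : ℝ) ^ (j + 1)) = ((N : ℕ) : ℝ) := by rw [hNdef, Nat.cast_pow]
  rw [en, eN, ← inv_pow]
  refine h2.trans (le_of_eq ?_)
  ring

/-- ★★★ **THE LEMMA-2.4 LETTER OF C1 FOR A CUBE MEETING `Ω_{j+1}`, ADMISSIBILITY-FREE** — as `lemma24_letter_twoLevel` without `hH`: the `hL24` hypothesis of
`B6SectADeltaACoerciveReductionV1.deltaAE_coercive_of_treeGauge_letters'` for configurations supported near ANY two-level cube given by label corners in the box
(margins, disjoint regions, index hypotheses `hIS`∕`hIB` only). [cite: Balaban1984PropagatorsII, Lemma 2.4 (2.128) p.245, (2.19) p.226, (2.89) p.239, (2.121) p.244] -/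
theorem lemma24_letter_twoLevel_noAdm (hd : 2 ≤ P.d) (D : Domains P) (hjk : j + 1 ≤ D.k) {Λs Λb : Finset (Fin P.d → ℤ)}
    (hΛs : ∀ y ∈ Λs, ∀ i, ((P.L ^ j : ℕ) : ℤ) ∣ y i) (hΛb : ∀ Y ∈ Λb, ∀ i, ((P.L ^ (j + 1) : ℕ) : ℤ) ∣ Y i)
    (hboxS : ∀ y ∈ Λs, ∀ i, ((P.L ^ (j + 1) : ℕ) : ℤ) ≤ y i ∧ y i + ((P.L ^ j : ℕ) : ℤ) + ((P.L ^ (j + 1) : ℕ) : ℤ) ≤ ((P.sitesPerDir 0 : ℕ) : ℤ))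
    (hboxB : ∀ Y ∈ Λb, ∀ i, ((P.L ^ (j + 1) : ℕ) : ℤ) ≤ Y i ∧ Y i + 2 * ((P.L ^ (j + 1) : ℕ) : ℤ) ≤ ((P.sitesPerDir 0 : ℕ) : ℤ))
    (hdisj : ∀ y ∈ Λs, corner (P.L ^ j * P.L) y ∉ Λb)
    (hIS : ∀ c ∈ idxS (P.L ^ j) P.L Λs Λb, D.LamBond j (labBond j c))
    (hIB : ∀ C ∈ coarseBonds (P.L ^ (j + 1)) Λb, D.LamBond (j + 1) (labBond (j + 1) C))
    (c : ℝ) {w : BondIdx D → ℝ} {w₀ : ℝ} (hw₀ : 0 ≤ w₀) (hw : ∀ i, w₀ ≤ w i) (B : BondSpace P)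
    (hsupp : ∀ z ∈ pbox (periodV1 P), ∀ μ : Fin P.d, (z, μ) ∉ bonds₂ (P.L ^ j) P.L Λs Λb → WithLp.ofLp B ⟨castZ z, μ⟩ = 0)
    (hTs : ∀ y ∈ Λs, ∀ x ∈ iterBlock j (labSite j y), stairSum (WithLp.ofLp B) (cornerV1 j (labSite j y)) x = 0)
    (hTb : ∀ Y ∈ Λb, ∀ x ∈ iterBlock (j + 1) (labSite (j + 1) Y), stairSum (WithLp.ofLp B) (cornerV1 (j + 1) (labSite (j + 1) Y)) x = 0) :
    (12 * (P.d : ℝ) ^ 2 * (1 + 12 * (P.d : ℝ) * ((P.L : ℝ) ^ j) ^ 2))⁻¹ * (((P.L : ℝ) ^ (j + 1)) ^ (P.d + 1))⁻¹ *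
        min (c ^ 2 / 2) (w₀ / ((P.L : ℝ) ^ (j + 1)) ^ (P.d - 2)) * ‖B‖ ^ 2 ≤
      ‖dcE c B‖ ^ 2 + ∑ i, w i * QE D B i ^ 2 := by
  have hj : j + 1 ≤ P.m + P.K := le_trans hjk D.hk
  have h24 := lemma24_twoLevel_V1_noAdm hd hj hΛs hΛb hboxS hboxB hdisj B hsupp hTs hTb
  -- which label faces are coarse sites of the box (for the injectivity of the index maps)
  have hn1 : 1 ≤ P.L ^ j := Nat.one_le_pow _ _ P.L_pos
  have hN1 : 1 ≤ P.L ^ (j + 1) := Nat.one_le_pow _ _ P.L_pos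
  have hnN : P.L ^ j ≤ P.L ^ (j + 1) := Nat.pow_le_pow_right P.L_pos (Nat.le_succ j)
  have hn1Z : (1 : ℤ) ≤ ((P.L ^ j : ℕ) : ℤ) := Int.ofNat_le.mpr hn1
  have hnNZ : ((P.L ^ j : ℕ) : ℤ) ≤ ((P.L ^ (j + 1) : ℕ) : ℤ) := Int.ofNat_le.mpr hnN
  have hS : ∀ c ∈ idxS (P.L ^ j) P.L Λs Λb, c.1 ∈ coarseSites (P.L ^ j) (periodV1 P) := by
    intro c hc
    have hcb := idxS_subset Λs Λb hc
    refine mem_coarseSites.2 ⟨mem_pbox.2 fun i => ?_, dvd_of_mem_coarseBonds hΛs hcb⟩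
    show 0 ≤ c.1 i ∧ c.1 i < ((P.sitesPerDir 0 : ℕ) : ℤ)
    rcases mem_coarseBonds.1 hcb with h1 | h1
    · have := hboxS _ h1 i; constructor <;> omega
    · have := hboxS _ h1 i
      rw [add_smul_unitVec_apply] at this
      split_ifs at this <;> constructor <;> omega
  have hT : ∀ C ∈ coarseBonds (P.L ^ (j + 1)) Λb, C.1 ∈ coarseSites (P.L ^ (j + 1)) (periodV1 P) := by
    intro C hC
    refine mem_coarseSites.2 ⟨mem_pbox.2 fun i => ?_, dvd_of_mem_coarseBonds hΛb hC⟩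
    show 0 ≤ C.1 i ∧ C.1 i < ((P.sitesPerDir 0 : ℕ) : ℤ)
    rcases mem_coarseBonds.1 hC with h1 | h1
    · have := hboxB _ h1 i; constructor <;> omega
    · have := hboxB _ h1 i
      rw [add_smul_unitVec_apply] at this
      split_ifs at this <;> constructor <;> omega
  have hQ := sum_weight_QE_twoLevel_ge D hjk hw₀ hw hS hT hIS hIB B
  -- abbreviations
  set K : ℝ := 12 * (P.d : ℝ) ^ 2 * (1 + 12 * (P.d : ℝ) * ((P.L : ℝ) ^ j) ^ 2) with hK
  set α : ℝ := (((P.L : ℝ) ^ (j + 1)) ^ (P.d + 1))⁻¹ with hα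
  set r : ℝ := ((P.L : ℝ) ^ j) ^ (P.d - 2) with hr
  set R : ℝ := ((P.L : ℝ) ^ (j + 1)) ^ (P.d - 2) with hR
  set QS : ℝ := ∑ c ∈ idxS (P.L ^ j) P.L Λs Λb, bondAvgIter j (WithLp.ofLp B) (labBond j c) ^ 2 with hQS
  set QB : ℝ := ∑ C ∈ coarseBonds (P.L ^ (j + 1)) Λb, bondAvgIter (j + 1) (WithLp.ofLp B) (labBond (j + 1) C) ^ 2 with hQB
  set SC : ℝ := ∑ p : Plaq P 0, LatticeFieldCalculus.curl 1 (WithLp.ofLp B) p ^ 2 with hSC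
  set μ : ℝ := min (c ^ 2 / 2) (w₀ / R) with hμ
  have hL0 : (0 : ℝ) < (P.L : ℝ) := by exact_mod_cast P.L_pos
  have hK0 : 0 < K := by rw [hK]; positivity
  have hR0 : 0 < R := by rw [hR]; positivity
  have hr0 : 0 ≤ r := by rw [hr]; positivity
  have hrR : r ≤ R := by
    rw [hr, hR]
    exact pow_le_pow_left₀ (by positivity) (pow_le_pow_right₀ (by exact_mod_cast P.L_pos) (Nat.le_succ j)) _
  have hQS0 : 0 ≤ QS := sum_nonneg fun _ _ => sq_nonneg _
  have hQB0 : 0 ≤ QB := sum_nonneg fun _ _ => sq_nonneg _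
  have hSC0 : 0 ≤ SC := sum_nonneg fun _ _ => sq_nonneg _
  have hμ0 : 0 ≤ μ := le_min (by positivity) (div_nonneg hw₀ hR0.le)
  -- `μ·(rQ^S + RQ^B + 2Σ_p) ≤ w₀(Q^S + Q^B) + c²Σ_p`
  have h1 : μ * (r * QS) ≤ w₀ * QS := by
    calc μ * (r * QS) ≤ (w₀ / R) * (R * QS) := mul_le_mul (min_le_right _ _) (mul_le_mul_of_nonneg_right hrR hQS0) (by positivity) (div_nonneg hw₀ hR0.le)
      _ = w₀ * QS := by field_simp
  have h2 : μ * (R * QB) ≤ w₀ * QB := by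
    calc μ * (R * QB) ≤ (w₀ / R) * (R * QB) := mul_le_mul_of_nonneg_right (min_le_right _ _) (by positivity)
      _ = w₀ * QB := by field_simp
  have h3 : μ * (2 * SC) ≤ c ^ 2 * SC := by
    calc μ * (2 * SC) ≤ (c ^ 2 / 2) * (2 * SC) := mul_le_mul_of_nonneg_right (min_le_left _ _) (by positivity)
      _ = c ^ 2 * SC := by ring
  have h24' : α * ‖B‖ ^ 2 ≤ K * (r * QS + R * QB + 2 * SC) := h24
  rw [normSq_dcE_eq]
  calc K⁻¹ * α * μ * ‖B‖ ^ 2 = μ * (K⁻¹ * (α * ‖B‖ ^ 2)) := by ring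
    _ ≤ μ * (K⁻¹ * (K * (r * QS + R * QB + 2 * SC))) :=
        mul_le_mul_of_nonneg_left (mul_le_mul_of_nonneg_left h24' (inv_nonneg.2 hK0.le)) hμ0
    _ = μ * (r * QS) + μ * (R * QB) + μ * (2 * SC) := by rw [← mul_assoc K⁻¹, inv_mul_cancel₀ hK0.ne', one_mul]; ring
    _ ≤ w₀ * QS + w₀ * QB + c ^ 2 * SC := add_le_add (add_le_add h1 h2) h3
    _ = w₀ * (QS + QB) + c ^ 2 * SC := by ring
    _ ≤ (∑ i, w i * QE D B i ^ 2) + c ^ 2 * SC := by linarith [hQ]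
    _ = c ^ 2 * SC + ∑ i, w i * QE D B i ^ 2 := by ring

end NoAdm

/-! ## §6 (v1.2, append-only). ★★★ The master editions: (2.121) as the vanishing of the periodic lift on the blocks' tree bonds -/

section Tree2

variable {j : ℕ}

/-- the two end points of a tree bond of `Bᵏ(ȳ)` (labels over the corner) cast into `Bᵏ(ȳ)` — so a configuration vanishing on the bonds INSIDE the block vanishes on its
tree bonds (n06-j's `ends_mem_iterBlock_of_treeBond`, re-proved here to keep the import closure inside the B6 lineage).
[cite: Balaban1984PropagatorsII, (2.121) p.244; Balaban1984PropagatorsI, (1.7) p.18; folklore] -/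
theorem castZ_ends_mem_iterBlock_of_treeBond {k : ℕ} (hk : k ≤ P.m + P.K) (yk : Site P k) {b : (Fin P.d → ℤ) × Fin P.d}
    (hb : b ∈ treeBonds (P.L ^ k) (toZ (cornerV1 k yk))) :
    castZ (P := P) b.1 ∈ iterBlock k yk ∧ (castZ (P := P) b.1).shift b.2 ∈ iterBlock k yk := by
  obtain ⟨hw, -, hlast⟩ := mem_treeBonds.1 hb
  refine ⟨castZ_mem_iterBlock_of_mem_block hk yk hw, ?_⟩
  have hw' : b.1 + unitVec b.2 ∈ B6Elimination.block (P.L ^ k) (toZ (cornerV1 k yk)) := by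
    refine B6Elimination.mem_block.2 fun i => ?_
    obtain ⟨h0, h1⟩ := B6Elimination.mem_block.1 hw i
    rw [show b.1 + unitVec b.2 = b.1 + (1 : ℤ) • unitVec b.2 by rw [one_smul], add_smul_unitVec_apply]
    by_cases h : i = b.2
    · subst h; rw [if_pos rfl]; constructor <;> omega
    · rw [if_neg h]; constructor <;> omega
  rw [← castZ_add_unitVec]; exact castZ_mem_iterBlock_of_mem_block hk yk hw'

/-- ★ the tree-bond form of (2.121) at a block from EITHER the vanishing of the corner staircase sums on it OR the vanishing of `B` on every bond inside it.
[cite: Balaban1984PropagatorsII, (2.121) p.244; Balaban1984PropagatorsI, (1.7) p.18] -/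
theorem liftB_eq_zero_of_treeBond_or {k : ℕ} (hk : k ≤ P.m + P.K) (B : BondSpace P) (yk : Site P k)
    (h : (∀ x ∈ iterBlock k yk, stairSum (WithLp.ofLp B) (cornerV1 k yk) x = 0) ∨
      (∀ b : PBond P 0, b.src ∈ iterBlock k yk → b.tgt ∈ iterBlock k yk → WithLp.ofLp B b = 0)) :
    ∀ b ∈ treeBonds (P.L ^ k) (toZ (cornerV1 k yk)), liftB B b = 0 := by
  intro b hb
  rcases h with h | h
  · exact liftB_eq_zero_of_treeBond_at hk B yk h b hb
  · obtain ⟨h1, h2⟩ := castZ_ends_mem_iterBlock_of_treeBond hk yk hb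
    exact h ⟨castZ b.1, b.2⟩ h1 h2

/-- ★★★ **THE TWO-SCALE LEMMA-2.4 INEQUALITY ON `T^{(0)}`, TREE-GAUGE HYPOTHESES IN BOND FORM** (the master edition): as `lemma24_twoLevel_V1_noAdm` but with (2.121)
stated directly as the vanishing of the periodic lift `liftB B` on b06's tree bonds of every block of `Λs` (scale `Lʲ`) and of `Λb` (scale `L^{j+1}`) — the form both the
staircase-sum hypothesis (`liftB_eq_zero_of_treeBond_at`) and the vanishing of `B` inside a block (tree bonds lie inside their block) reduce to.
[cite: Balaban1984PropagatorsII, Lemma 2.4 (2.128) p.245, (2.89) p.239, (2.121) p.244; Balaban1984PropagatorsI, (1.18) p.20] -/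
theorem lemma24_twoLevel_V1_tree (hd : 2 ≤ P.d) (hj : j + 1 ≤ P.m + P.K) {Λs Λb : Finset (Fin P.d → ℤ)}
    (hΛs : ∀ y ∈ Λs, ∀ i, ((P.L ^ j : ℕ) : ℤ) ∣ y i) (hΛb : ∀ Y ∈ Λb, ∀ i, ((P.L ^ (j + 1) : ℕ) : ℤ) ∣ Y i)
    (hboxS : ∀ y ∈ Λs, ∀ i, ((P.L ^ (j + 1) : ℕ) : ℤ) ≤ y i ∧ y i + ((P.L ^ j : ℕ) : ℤ) + ((P.L ^ (j + 1) : ℕ) : ℤ) ≤ ((P.sitesPerDir 0 : ℕ) : ℤ))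
    (hboxB : ∀ Y ∈ Λb, ∀ i, ((P.L ^ (j + 1) : ℕ) : ℤ) ≤ Y i ∧ Y i + 2 * ((P.L ^ (j + 1) : ℕ) : ℤ) ≤ ((P.sitesPerDir 0 : ℕ) : ℤ))
    (hdisj : ∀ y ∈ Λs, corner (P.L ^ j * P.L) y ∉ Λb)
    (B : BondSpace P)
    (hsupp : ∀ z ∈ pbox (periodV1 P), ∀ μ : Fin P.d, (z, μ) ∉ bonds₂ (P.L ^ j) P.L Λs Λb → WithLp.ofLp B ⟨castZ z, μ⟩ = 0)
    (hTs : ∀ y ∈ Λs, ∀ b ∈ treeBonds (P.L ^ j) y, liftB B b = 0)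
    (hTb : ∀ Y ∈ Λb, ∀ b ∈ treeBonds (P.L ^ (j + 1)) Y, liftB B b = 0) :
    (((P.L : ℝ) ^ (j + 1)) ^ (P.d + 1))⁻¹ * ‖B‖ ^ 2 ≤
      12 * (P.d : ℝ) ^ 2 * (1 + 12 * (P.d : ℝ) * ((P.L : ℝ) ^ j) ^ 2) *
        (((P.L : ℝ) ^ j) ^ (P.d - 2) * ∑ c ∈ idxS (P.L ^ j) P.L Λs Λb, bondAvgIter j (WithLp.ofLp B) (labBond j c) ^ 2 +
          ((P.L : ℝ) ^ (j + 1)) ^ (P.d - 2) * ∑ C ∈ coarseBonds (P.L ^ (j + 1)) Λb, bondAvgIter (j + 1) (WithLp.ofLp B) (labBond (j + 1) C) ^ 2 +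
          2 * ∑ p : Plaq P 0, LatticeFieldCalculus.curl 1 (WithLp.ofLp B) p ^ 2) := by
  obtain ⟨hNn, hn1, hnN⟩ := pow_facts (P := P) j
  have hj0 : j ≤ P.m + P.K := le_trans (Nat.le_succ j) hj
  have hL1 : 1 ≤ P.L := P.L_pos
  have hN1 : 1 ≤ P.L ^ (j + 1) := Nat.one_le_pow _ _ P.L_pos
  set n : ℕ := P.L ^ j with hndef
  set N : ℕ := P.L ^ (j + 1) with hNdef
  set X : Cfg P.d := liftR n P.L Λs Λb B with hXdef
  -- the hypotheses of the ℤᵈ lemma for the restricted lift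
  have hΛb' : ∀ Y ∈ Λb, ∀ i, ((n * P.L : ℕ) : ℤ) ∣ Y i := by rw [hNn]; exact hΛb
  have hB0 : ∀ b, b ∉ bonds₂ n P.L Λs Λb → X b = 0 := fun b hb => liftR_of_not_mem hb
  have hn1Z : (1 : ℤ) ≤ ((n : ℕ) : ℤ) := Int.ofNat_le.mpr hn1
  have hN1Z : (1 : ℤ) ≤ ((N : ℕ) : ℤ) := Int.ofNat_le.mpr hN1
  have hnNZ : ((n : ℕ) : ℤ) ≤ ((N : ℕ) : ℤ) := Int.ofNat_le.mpr hnN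
  have hcsS : ∀ y ∈ Λs, y ∈ coarseSites (P.L ^ j) (periodV1 P) := fun y hy =>
    mem_coarseSites.2 ⟨mem_pbox.2 fun i => ⟨by have := (hboxS y hy i).1; omega, by
      show y i < ((P.sitesPerDir 0 : ℕ) : ℤ); have := (hboxS y hy i).2; omega⟩, hΛs y hy⟩
  have hcsB : ∀ Y ∈ Λb, Y ∈ coarseSites (P.L ^ (j + 1)) (periodV1 P) := fun Y hY =>
    mem_coarseSites.2 ⟨mem_pbox.2 fun i => ⟨by have := (hboxB Y hY i).1; omega, by
      show Y i < ((P.sitesPerDir 0 : ℕ) : ℤ); have := (hboxB Y hY i).2; omega⟩, hΛb Y hY⟩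
  have hTs' : ∀ y ∈ Λs, ∀ b ∈ treeBonds n y, X b = 0 := by
    intro y hy b hb
    have hbU : b ∈ bonds₂ n P.L Λs Λb :=
      mem_union_left _ (mem_lamBonds.2 (Or.inl (mem_lam.2 ⟨y, hy, (mem_treeBonds.1 hb).1⟩)))
    rw [hXdef, liftR_of_mem hbU]
    exact hTs y hy b hb
  have hTb' : ∀ Y ∈ Λb, ∀ b ∈ treeBonds (n * P.L) Y, X b = 0 := by
    intro Y hY b hb
    rw [hNn] at hb
    have hbU : b ∈ bonds₂ n P.L Λs Λb := by
      refine mem_union_right _ (mem_lamBonds.2 (Or.inl (mem_lam.2 ⟨Y, hY, ?_⟩)))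
      rw [hNn]; exact (mem_treeBonds.1 hb).1
    rw [hXdef, liftR_of_mem hbU]
    exact hTb Y hY b hb
  -- the ℤᵈ two-scale letter
  have h := B6Lemma24TwoScale.lemma24_twoScale_noAdm hd hn1 hL1 hΛs hΛb' hdisj X hB0 hTs' hTb'
  rw [hNn] at h
  -- the four terms
  have hU : ∀ b ∈ bonds₂ n P.L Λs Λb, b.1 ∈ pbox (periodV1 P) := by
    intro b hb
    rcases mem_union.1 hb with hb | hb
    · rcases mem_lamBonds.1 hb with h1 | h1
      · obtain ⟨y, hy, hby⟩ := mem_lam.1 h1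
        refine mem_pbox.2 fun i => ?_
        obtain ⟨a1, a2⟩ := B6Elimination.mem_block.1 hby i
        have := hboxS y hy i
        exact ⟨by omega, by show b.1 i < ((P.sitesPerDir 0 : ℕ) : ℤ); omega⟩
      · obtain ⟨y, hy, hby⟩ := mem_lam.1 h1
        refine mem_pbox.2 fun i => ?_
        obtain ⟨a1, a2⟩ := B6Elimination.mem_block.1 hby i
        have := hboxS y hy i
        rw [add_unitVec_apply] at a1 a2
        constructor
        · split_ifs at a1 <;> omega
        · show b.1 i < ((P.sitesPerDir 0 : ℕ) : ℤ); split_ifs at a2 <;> omega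
    · rw [hNn] at hb
      rcases mem_lamBonds.1 hb with h1 | h1
      · obtain ⟨Y, hY, hbY⟩ := mem_lam.1 h1
        refine mem_pbox.2 fun i => ?_
        obtain ⟨a1, a2⟩ := B6Elimination.mem_block.1 hbY i
        have := hboxB Y hY i
        exact ⟨by omega, by show b.1 i < ((P.sitesPerDir 0 : ℕ) : ℤ); omega⟩
      · obtain ⟨Y, hY, hbY⟩ := mem_lam.1 h1
        refine mem_pbox.2 fun i => ?_
        obtain ⟨a1, a2⟩ := B6Elimination.mem_block.1 hbY i
        have := hboxB Y hY i
        rw [add_unitVec_apply] at a1 a2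
        constructor
        · split_ifs at a1 <;> omega
        · show b.1 i < ((P.sitesPerDir 0 : ℕ) : ℤ); split_ifs at a2 <;> omega
  have hNrm : normSq₂ n P.L Λs Λb X = ‖B‖ ^ 2 := normSq₂_liftR hsupp hU
  have hQS : ∑ c ∈ idxS n P.L Λs Λb, q1Term n X c = ∑ c ∈ idxS n P.L Λs Λb, bondAvgIter j (WithLp.ofLp B) (labBond j c) ^ 2 := by
    refine sum_congr rfl fun c hc => q1Term_liftR_eq hj0 hsupp ?_ ?_
    · have hcb := idxS_subset Λs Λb hc
      refine mem_coarseSites.2 ⟨mem_pbox.2 fun i => ?_, dvd_of_mem_coarseBonds hΛs hcb⟩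
      rcases mem_coarseBonds.1 hcb with h1 | h1
      · exact mem_pbox.1 (mem_coarseSites.1 (hcsS _ h1)).1 i
      · have := hboxS _ h1 i
        rw [add_smul_unitVec_apply] at this
        constructor
        · split_ifs at this <;> omega
        · show c.1 i < ((P.sitesPerDir 0 : ℕ) : ℤ); split_ifs at this <;> omega
    · intro i
      have hcb := idxS_subset Λs Λb hc
      show c.1 i + 2 * ((n : ℕ) : ℤ) ≤ ((P.sitesPerDir 0 : ℕ) : ℤ)
      rcases mem_coarseBonds.1 hcb with h1 | h1
      · have := (hboxS _ h1 i).2; omega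
      · have := (hboxS _ h1 i).2
        rw [add_smul_unitVec_apply] at this
        split_ifs at this <;> omega
  have hQB : q1Of (P.L ^ (j + 1)) Λb X = ∑ C ∈ coarseBonds (P.L ^ (j + 1)) Λb, bondAvgIter (j + 1) (WithLp.ofLp B) (labBond (j + 1) C) ^ 2 := by
    rw [q1Of]
    refine sum_congr rfl fun C hC => q1Term_liftR_eq hj hsupp ?_ ?_
    · refine mem_coarseSites.2 ⟨mem_pbox.2 fun i => ?_, dvd_of_mem_coarseBonds hΛb hC⟩
      rcases mem_coarseBonds.1 hC with h1 | h1
      · exact mem_pbox.1 (mem_coarseSites.1 (hcsB _ h1)).1 i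
      · have := hboxB _ h1 i
        rw [add_smul_unitVec_apply] at this
        constructor
        · split_ifs at this <;> omega
        · show C.1 i < ((P.sitesPerDir 0 : ℕ) : ℤ); split_ifs at this <;> omega
    · intro i
      show C.1 i + 2 * ((N : ℕ) : ℤ) ≤ ((P.sitesPerDir 0 : ℕ) : ℤ)
      rcases mem_coarseBonds.1 hC with h1 | h1
      · have := (hboxB _ h1 i).2; omega
      · have := (hboxB _ h1 i).2
        rw [add_smul_unitVec_apply] at this
        split_ifs at this <;> omega
  have hPS : d1Sq n Λs X ≤ ∑ p : Plaq P 0, LatticeFieldCalculus.curl 1 (WithLp.ofLp B) p ^ 2 := by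
    refine d1Sq_liftR_le hsupp fun y hy i => ?_
    have := hboxS y hy i
    show 1 ≤ y i ∧ y i + ((n : ℕ) : ℤ) + 1 ≤ ((P.sitesPerDir 0 : ℕ) : ℤ)
    constructor <;> omega
  have hPB : d1Sq (P.L ^ (j + 1)) Λb X ≤ ∑ p : Plaq P 0, LatticeFieldCalculus.curl 1 (WithLp.ofLp B) p ^ 2 := by
    refine d1Sq_liftR_le hsupp fun Y hY i => ?_
    have := hboxB Y hY i
    show 1 ≤ Y i ∧ Y i + ((N : ℕ) : ℤ) + 1 ≤ ((P.sitesPerDir 0 : ℕ) : ℤ)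
    constructor <;> omega
  -- assemble
  rw [hNrm, hQS, hQB] at h
  have hK0 : (0 : ℝ) ≤ 12 * (P.d : ℝ) ^ 2 * (1 + 12 * (P.d : ℝ) * ((n : ℕ) : ℝ) ^ 2) := by positivity
  have h2 := h.trans (mul_le_mul_of_nonneg_left (add_le_add (add_le_add le_rfl hPS) hPB) hK0)
  have en : ((P.L : ℝ) ^ j) = ((n : ℕ) : ℝ) := by rw [hndef, Nat.cast_pow]
  have eN : ((P.L : ℝ) ^ (j + 1)) = ((N : ℕ) : ℝ) := by rw [hNdef, Nat.cast_pow]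
  rw [en, eN, ← inv_pow]
  refine h2.trans (le_of_eq ?_)
  ring

/-- ★★★ **THE LEMMA-2.4 LETTER OF C1 FOR A CUBE MEETING `Ω_{j+1}`, TREE-GAUGE HYPOTHESES IN BOND FORM** (master edition of `lemma24_letter_twoLevel_noAdm`).
[cite: Balaban1984PropagatorsII, Lemma 2.4 (2.128) p.245, (2.19) p.226, (2.89) p.239, (2.121) p.244] -/
theorem lemma24_letter_twoLevel_tree (hd : 2 ≤ P.d) (D : Domains P) (hjk : j + 1 ≤ D.k) {Λs Λb : Finset (Fin P.d → ℤ)}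
    (hΛs : ∀ y ∈ Λs, ∀ i, ((P.L ^ j : ℕ) : ℤ) ∣ y i) (hΛb : ∀ Y ∈ Λb, ∀ i, ((P.L ^ (j + 1) : ℕ) : ℤ) ∣ Y i)
    (hboxS : ∀ y ∈ Λs, ∀ i, ((P.L ^ (j + 1) : ℕ) : ℤ) ≤ y i ∧ y i + ((P.L ^ j : ℕ) : ℤ) + ((P.L ^ (j + 1) : ℕ) : ℤ) ≤ ((P.sitesPerDir 0 : ℕ) : ℤ))
    (hboxB : ∀ Y ∈ Λb, ∀ i, ((P.L ^ (j + 1) : ℕ) : ℤ) ≤ Y i ∧ Y i + 2 * ((P.L ^ (j + 1) : ℕ) : ℤ) ≤ ((P.sitesPerDir 0 : ℕ) : ℤ))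
    (hdisj : ∀ y ∈ Λs, corner (P.L ^ j * P.L) y ∉ Λb)
    (hIS : ∀ c ∈ idxS (P.L ^ j) P.L Λs Λb, D.LamBond j (labBond j c))
    (hIB : ∀ C ∈ coarseBonds (P.L ^ (j + 1)) Λb, D.LamBond (j + 1) (labBond (j + 1) C))
    (c : ℝ) {w : BondIdx D → ℝ} {w₀ : ℝ} (hw₀ : 0 ≤ w₀) (hw : ∀ i, w₀ ≤ w i) (B : BondSpace P)
    (hsupp : ∀ z ∈ pbox (periodV1 P), ∀ μ : Fin P.d, (z, μ) ∉ bonds₂ (P.L ^ j) P.L Λs Λb → WithLp.ofLp B ⟨castZ z, μ⟩ = 0)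
    (hTs : ∀ y ∈ Λs, ∀ b ∈ treeBonds (P.L ^ j) y, liftB B b = 0)
    (hTb : ∀ Y ∈ Λb, ∀ b ∈ treeBonds (P.L ^ (j + 1)) Y, liftB B b = 0) :
    (12 * (P.d : ℝ) ^ 2 * (1 + 12 * (P.d : ℝ) * ((P.L : ℝ) ^ j) ^ 2))⁻¹ * (((P.L : ℝ) ^ (j + 1)) ^ (P.d + 1))⁻¹ *
        min (c ^ 2 / 2) (w₀ / ((P.L : ℝ) ^ (j + 1)) ^ (P.d - 2)) * ‖B‖ ^ 2 ≤
      ‖dcE c B‖ ^ 2 + ∑ i, w i * QE D B i ^ 2 := by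
  have hj : j + 1 ≤ P.m + P.K := le_trans hjk D.hk
  have h24 := lemma24_twoLevel_V1_tree hd hj hΛs hΛb hboxS hboxB hdisj B hsupp hTs hTb
  -- which label faces are coarse sites of the box (for the injectivity of the index maps)
  have hn1 : 1 ≤ P.L ^ j := Nat.one_le_pow _ _ P.L_pos
  have hN1 : 1 ≤ P.L ^ (j + 1) := Nat.one_le_pow _ _ P.L_pos
  have hnN : P.L ^ j ≤ P.L ^ (j + 1) := Nat.pow_le_pow_right P.L_pos (Nat.le_succ j)
  have hn1Z : (1 : ℤ) ≤ ((P.L ^ j : ℕ) : ℤ) := Int.ofNat_le.mpr hn1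
  have hnNZ : ((P.L ^ j : ℕ) : ℤ) ≤ ((P.L ^ (j + 1) : ℕ) : ℤ) := Int.ofNat_le.mpr hnN
  have hS : ∀ c ∈ idxS (P.L ^ j) P.L Λs Λb, c.1 ∈ coarseSites (P.L ^ j) (periodV1 P) := by
    intro c hc
    have hcb := idxS_subset Λs Λb hc
    refine mem_coarseSites.2 ⟨mem_pbox.2 fun i => ?_, dvd_of_mem_coarseBonds hΛs hcb⟩
    show 0 ≤ c.1 i ∧ c.1 i < ((P.sitesPerDir 0 : ℕ) : ℤ)
    rcases mem_coarseBonds.1 hcb with h1 | h1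
    · have := hboxS _ h1 i; constructor <;> omega
    · have := hboxS _ h1 i
      rw [add_smul_unitVec_apply] at this
      split_ifs at this <;> constructor <;> omega
  have hT : ∀ C ∈ coarseBonds (P.L ^ (j + 1)) Λb, C.1 ∈ coarseSites (P.L ^ (j + 1)) (periodV1 P) := by
    intro C hC
    refine mem_coarseSites.2 ⟨mem_pbox.2 fun i => ?_, dvd_of_mem_coarseBonds hΛb hC⟩
    show 0 ≤ C.1 i ∧ C.1 i < ((P.sitesPerDir 0 : ℕ) : ℤ)
    rcases mem_coarseBonds.1 hC with h1 | h1
    · have := hboxB _ h1 i; constructor <;> omega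
    · have := hboxB _ h1 i
      rw [add_smul_unitVec_apply] at this
      split_ifs at this <;> constructor <;> omega
  have hQ := sum_weight_QE_twoLevel_ge D hjk hw₀ hw hS hT hIS hIB B
  -- abbreviations
  set K : ℝ := 12 * (P.d : ℝ) ^ 2 * (1 + 12 * (P.d : ℝ) * ((P.L : ℝ) ^ j) ^ 2) with hK
  set α : ℝ := (((P.L : ℝ) ^ (j + 1)) ^ (P.d + 1))⁻¹ with hα
  set r : ℝ := ((P.L : ℝ) ^ j) ^ (P.d - 2) with hr
  set R : ℝ := ((P.L : ℝ) ^ (j + 1)) ^ (P.d - 2) with hR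
  set QS : ℝ := ∑ c ∈ idxS (P.L ^ j) P.L Λs Λb, bondAvgIter j (WithLp.ofLp B) (labBond j c) ^ 2 with hQS
  set QB : ℝ := ∑ C ∈ coarseBonds (P.L ^ (j + 1)) Λb, bondAvgIter (j + 1) (WithLp.ofLp B) (labBond (j + 1) C) ^ 2 with hQB
  set SC : ℝ := ∑ p : Plaq P 0, LatticeFieldCalculus.curl 1 (WithLp.ofLp B) p ^ 2 with hSC
  set μ : ℝ := min (c ^ 2 / 2) (w₀ / R) with hμ
  have hL0 : (0 : ℝ) < (P.L : ℝ) := by exact_mod_cast P.L_pos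
  have hK0 : 0 < K := by rw [hK]; positivity
  have hR0 : 0 < R := by rw [hR]; positivity
  have hr0 : 0 ≤ r := by rw [hr]; positivity
  have hrR : r ≤ R := by
    rw [hr, hR]
    exact pow_le_pow_left₀ (by positivity) (pow_le_pow_right₀ (by exact_mod_cast P.L_pos) (Nat.le_succ j)) _
  have hQS0 : 0 ≤ QS := sum_nonneg fun _ _ => sq_nonneg _
  have hQB0 : 0 ≤ QB := sum_nonneg fun _ _ => sq_nonneg _
  have hSC0 : 0 ≤ SC := sum_nonneg fun _ _ => sq_nonneg _
  have hμ0 : 0 ≤ μ := le_min (by positivity) (div_nonneg hw₀ hR0.le)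
  -- `μ·(rQ^S + RQ^B + 2Σ_p) ≤ w₀(Q^S + Q^B) + c²Σ_p`
  have h1 : μ * (r * QS) ≤ w₀ * QS := by
    calc μ * (r * QS) ≤ (w₀ / R) * (R * QS) := mul_le_mul (min_le_right _ _) (mul_le_mul_of_nonneg_right hrR hQS0) (by positivity) (div_nonneg hw₀ hR0.le)
      _ = w₀ * QS := by field_simp
  have h2 : μ * (R * QB) ≤ w₀ * QB := by
    calc μ * (R * QB) ≤ (w₀ / R) * (R * QB) := mul_le_mul_of_nonneg_right (min_le_right _ _) (by positivity)
      _ = w₀ * QB := by field_simp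
  have h3 : μ * (2 * SC) ≤ c ^ 2 * SC := by
    calc μ * (2 * SC) ≤ (c ^ 2 / 2) * (2 * SC) := mul_le_mul_of_nonneg_right (min_le_left _ _) (by positivity)
      _ = c ^ 2 * SC := by ring
  have h24' : α * ‖B‖ ^ 2 ≤ K * (r * QS + R * QB + 2 * SC) := h24
  rw [normSq_dcE_eq]
  calc K⁻¹ * α * μ * ‖B‖ ^ 2 = μ * (K⁻¹ * (α * ‖B‖ ^ 2)) := by ring
    _ ≤ μ * (K⁻¹ * (K * (r * QS + R * QB + 2 * SC))) :=
        mul_le_mul_of_nonneg_left (mul_le_mul_of_nonneg_left h24' (inv_nonneg.2 hK0.le)) hμ0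
    _ = μ * (r * QS) + μ * (R * QB) + μ * (2 * SC) := by rw [← mul_assoc K⁻¹, inv_mul_cancel₀ hK0.ne', one_mul]; ring
    _ ≤ w₀ * QS + w₀ * QB + c ^ 2 * SC := add_le_add (add_le_add h1 h2) h3
    _ = w₀ * (QS + QB) + c ^ 2 * SC := by ring
    _ ≤ (∑ i, w i * QE D B i ^ 2) + c ^ 2 * SC := by linarith [hQ]
    _ = c ^ 2 * SC + ∑ i, w i * QE D B i ^ 2 := by ring

end Tree2

end

end Literature.MathematicalPhysics.QuantumFieldTheory.Balaban1983to89.B6SectALemma24TwoLevelV1
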